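import Mathlib
import Literature.MathematicalPhysics.QuantumFieldTheory.Balaban1983to89.B10
import Literature.MathematicalPhysics.QuantumFieldTheory.Balaban1983to89.B10LargeField
import Literature.MathematicalPhysics.QuantumFieldTheory.Balaban1983to89.B10SectAGathering

/-!
# `Balaban1983to89.B10Assembly` — [Balaban1985UV3] assembled: the whole paper as ONE kernel implication
# "located printed leaves ⇒ Theorem 2 ∧ Theorem 1 (compact reading)", with the O(1) of (5) displayed

Paper sub-cell B10 of the Bałaban programme audit, generation 7 (revision v1.1 of generation 8: see REVISION v1.1 at
the end of this docstring).  Paper: T. Bałaban, *Ultraviolet stability of three-dimensional lattice pure gauge field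
theories*, Commun. Math. Phys. 102 (1985) 255–275 [Balaban1985UV3] (journal page = 254 + PDF page, given as
"p. N [PDF]"; «…» = verbatim from the page renders read as images).

STATUS OF THIS FILE.  Generations 1–6 of the cell typed Theorem 1 / Theorem 2 and the carrier (`B10`), the
large-field side and the interaction resummation (`B10LargeField`, `B10LargeFieldSum`), the nested minimizer
(`B10NestedMinimizer`), the log-det bound (63) (`B10LogDet63`) and the fourteen STEP LEAVES of Sects. A / C with the
one-step and whole-tower bookkeeping `StepLeaves ⇒ ((41)_k ∧ (47)_k → (41)_{k+1} ∧ (47)_{k+1})`, `… ⇒ Theorem 2`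
(`B10SectAGathering`).  What was still scattered over four modules' hypothesis lists is gathered here into ONE named
hypothesis bundle per run, `LeafSystem C T` (every field located in print — LEAF CENSUS below), over ONE record
`Consts` of the constants the paper treats as «O(1) … independent of ε, k», and the kernel checks the paper as one
implication

  `thm1Compact_and_thm2_of_leafSystem : (∀ i, LeafSystem C (T i)) → Thm1PrintedCompact runs ∧ Thm2Printed runs`

with the O(1) of (5) DISPLAYED: `O1 C gmin gmax = aI C + bW C gmin gmax + cR C + C.d` (§3) = interaction ((46) +
Sect. D line 1) + counterterm ((62)/(64)/(65)) + remainder ((41)) + large fields (pp. 273–274), whose only dependence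
beyond the family constants is on the coupling window [gmin, gmax] ∋ g_k through `max(|log gmin|, |log gmax|)` —
exactly the printed «and the constant O(1) is independent of ε, k, g_k in a bounded set» (p. 257 [3] l. 1) under the
audit reading recorded as cell GAPS G-B10-01 (bounded AWAY FROM 0: the one-sided `B10.Thm1Printed` is not derivable
from the printed leaves because of the «d(𝔤) log g_k|T₁^{(k)*}|» term of (62) p. 271, cf. `B10.Estep62_abs_le`,
`B10.Ecst_abs_le_window`, `B10.thm1Compact_of_thm1Printed`).

VALUE = a kernel certificate of the ARCHITECTURE of [Balaban1985UV3] (Sect. D assembled over Sects. A–C: located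
printed leaves with family-uniform constants ⇒ Theorem 2 ∧ Theorem 1 in the compact reading) — NOT a proof of any
leaf, NOT a construction of the densities (1)–(2), NOT summit progress.

ALSO HERE.  §4 `cumulant58_of_raw`: the cumulant remainder of (24) p. 262 / (58) p. 270 in its RAW printed form
«O(g₀⁷p¹⁸(g₀))|Ω₁|» / «O(g⁷p¹⁸(g_k))|B(Λ_{k+1})|» implies the leaf shape `B10SectAGathering.Cumulant58 P Cz C′` with
a constant C′ INDEPENDENT of k and ε (the printed «≤ O((L^kε)^{3+κ₀})|T₁^{(k)}|» discharged by
`B10SectAGathering.remainder_powerCounting`, 0 < κ₀ < ½), i.e. the k-uniformity that Theorem 2's leaves need at this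
term.  §4b (v1.1): the same discharge for the representation remainder of (33)/(60), the log-Z remainder of (35)/(61)
and the lower cumulant direction of (37)/(47) (`repr33_60_of_raw`, `decomp35_61_of_raw`, `cumulantLower_of_raw`), and
the remainder coefficient of (41)/(47) DISPLAYED as one closed-form real `rstarRaw` — a function of g, b₀, p₀, r₀, κ₀
and five cluster constants, not of k, ε.  §4c (v1.2): the last of those five that v1.1 still took as a bare O(1) —
the large-localization constant C₃ of the vacuum leaf — displayed too: p. 262 «the factor exp(−R), which is smaller
than arbitrary power of ε» / p. 264 «exp(−1/2 δ₀ dist(X, □₁ᶜ)) ≤ exp(−R₁r(g₀))» made quantitative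
(`largeLoc_le_rpow`: exp(−R₁r(g)) ≤ e^{−R₁}g^N for 0 < g ≤ 1, r₀ ≥ 1, 0 ≤ N ≤ R₁), whence `vacuumWhole_of_raw` and
the fully displayed coefficient `rstarRawR` under the located largeness R₁ ≥ 6 + 2κ₀ (not printed).
§5 `trivLeafSystem K`: the bundle is INHABITED for every depth K (the
trivial empty-interaction run on spacing 2^{−K}), so all leaves incl. the fourteen step leaves at every k < K are
jointly satisfiable as typed and the assembly is not vacuous.  §6: the finite-dimensional identities behind (20) and
(21) p. 261, with the support of D̃ an explicit block hypothesis (cell GAPS G-adv9-44).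

## LEAF CENSUS — the fields of `LeafSystem`, their printed locus, their nature, the cell record that audits them

* `ε, Tε, g_eq, sites_eq` — p. 256 [2] «g_k = g(L^kε)^{1/2}, |T₁^{(k)}| = Σ_{y∈T₁^{(k)}} 1 = Σ_{x∈T_η} η³ =
  (L^kε)^{−3}|T_ε|» — the model's definition (carrier scaling `B10.gRun`, `B10.sitesRun`).
* `scale_le_one` — p. 256 [2] «We terminate constructions of the densities ρ_k when we reach the unit lattice, or
  more exactly when L^kε = ε₀, where ε₀ is a positive constant depending on the coupling constant g only. Let us
  denote by K the index satisfying this equality, i.e. L^Kε = ε₀.» — standing convention, read ε₀ ≤ 1.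
* `g_le_one` — p. 267 [13] «for g_{k−1} sufficiently small», p. 273 [19] «for g_j sufficiently small» — standing
  smallness of the running coupling (G-B10-01: the window).
* `par` — the big-block size M₁ (p. 257 [3]) and p. 257, the sentence after the display (7): «we take ε₁ = g₀p(g₀),
  where p(g) = b₀(1 + log g⁻¹)^{p₀}, p₀ > 2 and b₀ is a sufficiently large absolute constant» fixed once for the
  family — convention.
* `spec`, `step0`, `noInt0` — (1) p. 256 [2] «ρ₀(U) = exp[−(1/g₀²)A(U) − E]» is (41)₀ ∧ (47)₀ with no interaction,
  Z- or remainder terms — definition ((43) p. 266: the interaction sum starts at j = 1).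
* `steps k` (the fourteen step leaves, every k < K) — (22)/(55), (24)/(58)–(59), (33)/(60), p. 265 / p. 270 vacuum
  sum, (35)/(61), the star count, p. 272 old terms, (36)/(41) identification, (62), the Z-term and remainder rates:
  see the census S-A1 … S-C6 of `B10SectAGathering`; printed proofs by reference to [13], [14], [15] (= the cell's
  B7–B9) and to the Higgs papers [8]–[10]; audited in GAPS G-B10-03, G-B10-05, G-B10-08, G-B10-11, G-adv9-30, C-adv9-43, C-adv9-45,
  C-adv9-46, G-adv9-44, G-adv9-47, E-adv9-48.
* `bound46`, `Λvol_nonneg` — (46) p. 267 [13] «Σ_{j=1}^k Σ_{Y_j}|𝒫_j(Y_j, U_k)| ≤ O(1)M₁³g²_{k−1}p²(g_{k−1})|Λ_k|»,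
  printed proof = the summation (43)–(45) «By the assumption n ≥ 2»; GAPS G-B10-05, G-adv9-47 (the clause Y_j ⊂ Ω_k).
* `starT_nonneg`, `starT_le` — p. 260 [6], the sentence after (18): «where χ = Π_{b∈Ω₁} χ({|A(b)| < g₀p²(g₀)}), g₀
  sufficiently small, and |Ω₁*| denotes the number of bonds belonging to Ω₁ minus the number of bonds in Ω₁^{(1)} and
  minus the number of bonds in the axial gauge fixing set.» (k ≥ 1: |B(Λ_{k+1})*| of (55) p. 269, |T₁^{(k)*}| of (62)
  p. 271, read the same way) — counting: a number of bonds of a subset of the unit 3-torus T₁^{(k)}, hence between 0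
  and the 3|T₁^{(k)}| bonds of the torus.  (v1 attributed to p. 260, in guillemets, a paraphrase of the definition of
  Ω₁* that is not a sentence of the paper; corrected in v1.1 — cell GAPS G-ref6-4.)
* `logσ₀_le`, `dg_le` — (18)–(22) pp. 260–261: σ₀ and d(𝔤) are constants of the group G, one group for the family.
* `logZT_le`, `PprT_le` — p. 273 [19] «From (25), which holds for arbitrary j, we get easily |E^{(j)}| ≤ O(1)|T₁^{(j)}|»
  applied to the third and fourth terms of (62) p. 271 «E^{(k)} = log σ₀|T₁^{(k)*}| + d(𝔤) log g_k|T₁^{(k)*}| +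
  log Z^{(k)}(T₁^{(k)}, 1) + Σ_X 𝒫′_{k+1}(g_k, X, 1)» ((25) p. 262 [8] «|𝒫′₁(g₀, X, U₁)| ≤ O(g₀)e^{−κ𝓛(X)}, where κ
  can be arbitrarily large if M₁ is sufficiently large.»; the bound for log Z^{(k)}(T₁^{(k)}, 1) is implicit in «we
  get easily») — one printed sentence; G-B10-01 records that the sentence drops the second term of (62).
* `rem_eq`, `Rm_zero`, `Rm_succ_le` — pp. 261–262 [7–8] «and we estimate the remainder by O(g₀⁷p¹⁸(g₀))|Ω₁| ≤
  O(ε^{3+κ₀})|T₁|, κ₀ > 0», p. 269 [15] «The remainders for both expressions are estimated by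
  O(g⁷p¹⁸(g_k))|B(Λ_{k+1})| ≤ O((L^kε)^{3+κ₀})|T₁^{(k)}|», p. 270 [16] «the error being of the order
  O((L^kε)^{3+κ₀})|T₁^{(k)}|», and the remainder sum «Σ_{j=0}^{k−1} O((L^jε)^{3+κ₀})|T₁^{(j)}|» of (41) p. 266 / (47)
  p. 267 — printed; that the O(·) is ONE constant for all k and all runs is the content, discharged for the raw form
  in §4 (`cumulant58_of_raw`) and §4b (`cumulantLower_of_raw`, `repr33_60_of_raw`, `decomp35_61_of_raw`; the
  coefficient displayed: `rstarRaw`).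
* `lf` — pp. 273–274 [19–20] «The analysis of Sect. 3.C [9], which is model independent, show that these small
  factors are enough to control all sums in (41), together with the second term in (65) ⟦(66)⟧. This gives the upper
  bound in (5).» — by reference to [9]; derived from per-plaquette leaves with d = 6/log L in
  `B10LargeFieldSum.largeFieldControl_of_resummation_gRun` (gen 4).

WHAT THE KERNEL CHECKS (all of it re-derived bookkeeping of Sect. D, pp. 272–274 [18–20]): (46) ⇒ one interaction
constant for the family and all k ≤ K (`pint_abs_le`, gen 2's `B10LargeField.interaction_uniform_of_46` +
`interaction_all_steps`); (62) + the census inputs ⇒ `|E^{(j)}| ≤ (a₁ + 3·dg·|log g_j|)|T₁^{(j)}|`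
(`LeafSystem.estep_abs_le`) ⇒ (64)–(65) on a coupling window (`LeafSystem.ecst_abs_le`, gen 3's
`B10.Ecst_abs_le_window`); the remainder recursion ⇒ `Rm k ≤ cR·|T₁^{(k)}|` uniformly in k (`LeafSystem.Rm_le`: the
geometric sum `B10.remainderSum_le` and `L^kε ≤ 1`); Theorem 2 (`thm2_of_leafSystem`, gen 6's `thm2_of_leaves`);
(41)_k ∧ (47)_k + the four piece bounds ⇒ (5)_k (`bounds5_of_leafSystem`, gen 1's `B10.bounds5At_of_ineqs`);
Theorem 1 in the compact reading (`thm1Compact_of_leafSystem`), and the conjunction.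

TYPING NOTE (a correction of quantifier placement in two earlier bookkeeping theorems, no mathematical content; cell
GAPS row of this generation): `B10.thm1Compact_of_thm2` and `B10LargeField.thm1Compact_of_thm2_leaves` take their
counterterm hypothesis `hE` for ALL real `gmin` (also `gmin ≤ 0`), which amounts to a counterterm bound uniform on
(0, gmax] — not dischargeable from the printed leaves for a family containing arbitrarily fine lattices (the log g_k
term once more).  They are correct but unusable as the last step, so the last step is re-derived here from
`B10.bounds5At_of_ineqs` under `0 < gmin` only, which is how `B10.Thm1PrintedCompact` is quantified.

NOT a construction, NOT an endorsement: `Consts` / `LeafSystem` only NAME hypotheses; whether the true densities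
(1)–(2) of lattice Yang–Mills₃ carry leaf systems with ε-independent constants is the content of [Balaban1985UV3] and
of its references [13]–[15], [8]–[10] — the object of the audit (GAPS ids above), never cited here as facts.  No
`axiom`, no `sorry`, no vendored fact; every hypothesis is an explicit binder or structure field.

REVISION v1.1 (generation 8; every v1 declaration byte-identical, additions only in §4b).  (i) Quotation hygiene
(cell REFEREE6 E68 / GAPS G-ref6-4): v1 attributed to p. 260 [6], in guillemets, a paraphrase of the definition of
Ω₁* that is not a sentence of the paper; the LEAF CENSUS bullet `starT_nonneg`, `starT_le` and item (L5) of
`LeafSystem` now display the printed sentence after (18).  (ii) ⟦sic⟧ recorded for the lower limit «k = k» printed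
under the first sum of (65) p. 273 (docstring of `LeafSystem.ecst_abs_le`; as in `B10.Ek_abs_le`).  (iii) The
locator of p(g) is p. 257 [3], the sentence after the display (7) ((7) itself is the decomposition of unity in the
characteristic functions χ).  (iv) New §4b (`rawConst7`, `raw18_le`, `raw7_le`, `Repr33_60Raw`, `repr33_60_of_raw`,
`Decomp35_61Raw`, `decomp35_61_of_raw`, `CumulantLowerRaw`, `cumulantLower_of_raw`, `rstarRaw`, `rstarRaw_eq`,
`rawConst_nonneg`, `rawConst7_nonneg`, `rstarRaw_nonneg`, `rmSucc_of_booking`).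

REVISION v1.2 (generation 9; every v1.1 declaration byte-identical, additions only in the new §4c).  v1.1's display
`rstarRaw` still carried ONE bare O(1): C₃, the constant of the large localizations in the vacuum leaf `VacuumWhole`
(«different mechanism, no R(g) lemma in the tree»).  §4c supplies that lemma from the printed mechanism — p. 262 [8]
«the exponential factor in (23) yields the factor exp(−R), which is smaller than arbitrary power of ε», p. 264 [10]
«with the constant proportional to an arbitrary power of g₀ … exp(−1/2 δ₀ dist(X, □₁ᶜ)) ≤ exp(−R₁r(g₀))», R = R₁r(g₀)
of p. 257 / R(g_j) = R₁r(g_j) of (39) p. 266 — in quantitative form (`largeLoc_le_rpow`, the exp(−R) analogue of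
`B10.smallFactor_le_pow`), and displays C₃ = C₃ʳ·e^{−R₁}·g^{6+2κ₀} (`rawConstR`, `rawR_le`, `VacuumWholeRaw`,
`vacuumWhole_of_raw`, `rstarRawR`, `rstarRawR_eq`, `rstarRawR_nonneg`; helpers `gRun_rpow_two_mul`, `largeLoc_run_le`,
`rawConstR_nonneg`).  Two hypotheses are thereby LOCATED that the print does not state: r₀ ≥ 1 (print leaves r₀
free — cell GAPS G-B10-02; for r₀ < 1 no bound exp(−R₁r(g)) ≤ C·g^N with N > 0 holds as g → 0) and R₁ ≥ 6 + 2κ₀ (the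
«arbitrary power» is the power R₁; cell SMALLNESS S-B10.9, DIVERGENCE D-b10.13).  Nothing of the paper is asserted:
the raw shape is a leaf (hypothesis), the lemmas are real arithmetic.  v1.2.1 (same generation): quotation hygiene in
the docstring of `largeLoc_le_rpow` — v1.2 displayed for (39) p. 266, in guillemets, a fragment that is not printed
(«M₁R(g_j)L^{−j}ξ, where …»); it now displays the printed (39) (render of p. 266 read as image); no declaration touched.
-/

noncomputable section

namespace Literature.MathematicalPhysics.QuantumFieldTheory.Balaban1983to89.B10Assembly

open Literature.MathematicalPhysics.QuantumFieldTheory.Balaban1983to89.B10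
open Literature.MathematicalPhysics.QuantumFieldTheory.Balaban1983to89.B10LargeField
  (NoInteraction0 interaction_all_steps interaction_uniform_of_46)
open Literature.MathematicalPhysics.QuantumFieldTheory.Balaban1983to89.B10SectAGathering

/-! ## 1. The constants of the construction common to a family of runs, and the leaf system of one run -/

section LeafSystem

/-- The ABSOLUTE CONSTANTS of the construction, common to all lattice approximations of one model (p. 256 [2]:
«g_k = g(L^kε)^{1/2}» — the bare coupling `g` and the block size `L` are fixed; p. 257 [3], after (7): `b₀, p₀`; the
big-block size `M₁` (p. 257); p. 262 [8] / p. 269 [15] the remainder exponent `κ₀`), together with the explicit values at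
which the printed O(1)'s are taken: `C46` = the O(1) of (46) p. 267 [13]; `σmax ≥ |log σ₀|` and `dg ≥ d(𝔤)` (the
group constants of (18)–(22) pp. 260–261, the same group for every run); `z` = the O(1) of `|log Z^{(k)}(T₁^{(k)}, 1)|
≤ O(1)|T₁^{(k)}|` and `aP` = the O(1) of `|Σ_X 𝒫′_{k+1}(g_k, X, 1)| ≤ O(1)|T₁^{(k)}|` (p. 273 [19]: «From (25), which
holds for arbitrary j, we get easily |E^{(j)}| ≤ O(1)|T₁^{(j)}|»); `rstar` = an upper bound for the coefficients of the
remainder sum `Σ_{j=0}^{k−1} O((L^jε)^{3+κ₀})|T₁^{(j)}|` of (41)/(47); `d` = the O(1) of the large-field control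
(pp. 273–274, `B10.LargeFieldControlPrinted`).  The sign conditions are the honest `O(1) ≥ 0`.  Only NAMES constants.
[cite: Balaban1985UV3, (5) p.256 + p.257 + (46) p.267 + (62) p.271 + (65) p.273] -/
structure Consts where
  /-- the bare coupling g of (1), p. 256 («g₀² = g²ε^{4−d} = g²ε (d = 3)») -/
  g : ℝ
  /-- the block size L of the renormalization transformation ([1, 4]) -/
  L : ℝ
  /-- the remainder exponent κ₀ > 0 of p. 262 / p. 269 -/
  κ₀ : ℝ
  /-- the big-block size M₁ (p. 257) -/
  M₁ : ℝ
  /-- p. 257, after (7): p(g) = b₀(1 + log g⁻¹)^{p₀} -/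
  b₀ : ℝ
  /-- p. 257, after (7): p(g) = b₀(1 + log g⁻¹)^{p₀}, «p₀ > 2» -/
  p₀ : ℝ
  /-- the O(1) of (46) p. 267 -/
  C46 : ℝ
  /-- a bound for |log σ₀| ((18)–(22) pp. 260–261) -/
  σmax : ℝ
  /-- a bound for d(𝔤) ((22) p. 261 «d(𝔤) denotes a dimension of the Lie algebra 𝔤», (62) p. 271) -/
  dg : ℝ
  /-- the O(1) of |log Z^{(k)}(T₁^{(k)}, 1)| ≤ O(1)|T₁^{(k)}| (p. 273, implicit in «we get easily») -/
  z : ℝ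
  /-- the O(1) of |Σ_X 𝒫′_{k+1}(g_k, X, 1)| ≤ O(1)|T₁^{(k)}| (p. 273 «From (25) …») -/
  aP : ℝ
  /-- an upper bound for the coefficients O((L^jε)^{3+κ₀}) of the remainder sum in (41)/(47) -/
  rstar : ℝ
  /-- the O(1) of the large-field control, pp. 273–274 -/
  d : ℝ
  g_pos : 0 < g
  one_lt_L : 1 < L
  κ₀_pos : 0 < κ₀
  M₁_nonneg : 0 ≤ M₁
  p₀_pos : 0 < p₀
  C46_nonneg : 0 ≤ C46
  σmax_nonneg : 0 ≤ σmax
  dg_nonneg : 0 ≤ dg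
  z_nonneg : 0 ≤ z
  aP_nonneg : 0 ≤ aP
  rstar_nonneg : 0 ≤ rstar
  d_nonneg : 0 ≤ d

/-- **THE LEAF SYSTEM OF ONE RUN** — everything [Balaban1985UV3] uses about one lattice approximation (torus T_ε,
spacing ε, K steps), as NAMED HYPOTHESES over gen 1's carrier `B10.TowerRun`, each located in print (LEAF CENSUS in
the module docstring):
(L1) the model scaling of p. 256 [2] «g_k = g(L^kε)^{1/2}, |T₁^{(k)}| = Σ_{y∈T₁^{(k)}} 1 = Σ_{x∈T_η} η³ = (L^kε)^{−3}|T_ε|»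
(`g_eq`, `sites_eq`) and the standing smallness «We terminate constructions of the densities ρ_k when we reach the
unit lattice, or more exactly when L^kε = ε₀, where ε₀ is a positive constant depending on the coupling constant g
only. Let us denote by K the index satisfying this equality, i.e. L^Kε = ε₀.» (p. 256) read as `L^kε ≤ 1` and
`g_k ≤ 1` for k ≤ K (`scale_le_one`, `g_le_one`; p. 267 «for g_{k−1} sufficiently small», p. 273 «for g_j
sufficiently small»); the constants of the run are the family's (`par`);
(L2) the binding of the abstract "(41), (47)" to the typed shapes (`spec`) and (1) p. 256 at k = 0 (`step0` =
`B10.Step0Printed`, `noInt0` = `B10LargeField.NoInteraction0`);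
(L3) for every step k < K the FOURTEEN step leaves of `B10SectAGathering.StepLeaves` ((22)/(55), (24)/(58)–(59),
(33)/(60), p. 265/p. 270 vacuum sum, (35)/(61), star count, p. 272 old terms, (36)/(41) identification, (36)/(62)
E^{(k)}, the Z-term and remainder rates) (`steps`);
(L4) **(46)** p. 267 [13] verbatim «Σ_{j=1}^k Σ_{Y_j} |𝒫_j(Y_j, U_k)| ≤ O(1)M₁³g²_{k−1}p²(g_{k−1})|Λ_k|» with the
family's O(1) = `C46` (`bound46`; |Λ_k| ≥ 0: `Λvol_nonneg`);
(L5) the inputs of **(65)** p. 273 [19] («From (25), which holds for arbitrary j, we get easily |E^{(j)}| ≤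
O(1)|T₁^{(j)}|») for the four terms of (62) p. 271 [17] «E^{(k)} = log σ₀|T₁^{(k)*}| + d(𝔤) log g_k|T₁^{(k)*}| +
log Z^{(k)}(T₁^{(k)}, 1) + Σ_X 𝒫′_{k+1}(g_k, X, 1)»: `0 ≤ |T₁^{(k)*}| ≤ 3|T₁^{(k)}|` (p. 260 [6], after (18): «and |Ω₁*|
denotes the number of bonds belonging to Ω₁ minus the number of bonds in Ω₁^{(1)} and minus the number of bonds in
the axial gauge fixing set.» — a number of bonds of a subset of the unit 3-torus, at most its 3|T₁^{(k)}| bonds)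
(`starT_nonneg`, `starT_le`), `|log σ₀| ≤ σmax`, `d(𝔤) ≤ dg`
(`logσ₀_le`, `dg_le`), `|log Z^{(k)}(T₁^{(k)}, 1)| ≤ z|T₁^{(k)}|` (`logZT_le`), `|Σ_X 𝒫′_{k+1}(g_k, X, 1)| ≤ aP|T₁^{(k)}|`
(`PprT_le`, from (25) p. 262 [8] «|𝒫′₁(g₀, X, U₁)| ≤ O(g₀)e^{−κ𝓛(X)}»);
(L6) the remainder unit and rate: `rem = (L^kε)^{3+κ₀}|T₁^{(k)}|` (p. 269 [15] «O((L^kε)^{3+κ₀})|T₁^{(k)}|»)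
(`rem_eq`), no remainder at k = 0 ((1) p. 256: `Rm_zero`) and the coefficient of (41)_{k+1} taken no larger than
`rstar` (`Rm_succ_le` — together with `StepLeaves.rmSucc` this says the printed O((L^kε)^{3+κ₀}) is an honest
O(1), bounded uniformly in k AND in the run: the uniformity «independent of ε, k» of Theorem 1 at this term);
(L7) the large-field control of pp. 273–274 [19–20] («The analysis of Sect. 3.C [9], which is model independent,
show that these small factors are enough to control all sums in (41), together with the second term in (65)
⟦(66)⟧. This gives the upper bound in (5).») with the family's constant `d` (`lf` = the shape of
`B10.LargeFieldControlPrinted`; derived from per-plaquette leaves with d = 6/log L in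
`B10LargeFieldSum.largeFieldControl_of_resummation_gRun`).
Only NAMES hypotheses; nothing of the series is asserted.  An instance built from the true densities (1)–(2) is
exactly what the audit of the series is about. [cite: Balaban1985UV3, pp.256–274] -/
structure LeafSystem (C : Consts) (T : TowerRun) where
  /-- the lattice spacing ε of this run (p. 256) -/
  ε : ℝ
  /-- |T_ε| = Σ_{x∈T_ε} ε³ ((3) p. 256) -/
  Tε : ℝ
  ε_pos : 0 < ε
  Tε_nonneg : 0 ≤ Tε
  /-- p. 256: g_k = g(L^kε)^{1/2} -/
  g_eq : ∀ k, T.g k = gRun C.g C.L ε k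
  /-- p. 256: |T₁^{(k)}| = (L^kε)^{−3}|T_ε| -/
  sites_eq : ∀ k, T.sites k = sitesRun C.L ε Tε k
  /-- p. 256: L^kε ≤ L^Kε = ε₀ ≤ 1 -/
  scale_le_one : ∀ k, k ≤ T.K → C.L ^ k * ε ≤ 1
  /-- «for g_{k−1} sufficiently small» (p. 267), «for g_j sufficiently small» (p. 273): g_k ≤ 1, k ≤ K -/
  g_le_one : ∀ k, k ≤ T.K → T.g k ≤ 1
  /-- the run uses the family's M₁, b₀, p₀ -/
  par : T.M₁ = C.M₁ ∧ T.b₀ = C.b₀ ∧ T.p₀ = C.p₀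
  /-- binding of `RunData.Ineq41_47` to (41) ∧ (47) -/
  spec : SpecOK T
  /-- (1) p. 256 at k = 0: (41)₀ ∧ (47)₀ -/
  step0 : Step0Printed T
  /-- (1) p. 256 / (43) p. 266: no interaction terms at k = 0 -/
  noInt0 : NoInteraction0 T
  /-- Sect. A (k = 0) / Sect. C (k ≥ 1): the fourteen step leaves, every k < K -/
  steps : ∀ k, k + 1 ≤ T.K → StepLeaves T k
  /-- |Λ_k| ≥ 0 -/
  Λvol_nonneg : ∀ (k : ℕ) (h : T.Hist k), 0 ≤ T.Λvol k h
  /-- (46) p. 267 with the family's O(1) -/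
  bound46 : ∀ k, 1 ≤ k → k ≤ T.K → ∀ (h : T.Hist k) (U : T.Cfg k),
    |T.Pint k h U| ≤ C.C46 * T.M₁ ^ 3 * ((T.g (k - 1)) ^ 2 * (pFun T.b₀ T.p₀ (T.g (k - 1))) ^ 2) * T.Λvol k h
  /-- |T₁^{(k)*}| ≥ 0 (p. 260: a set of bonds) -/
  starT_nonneg : ∀ (k : ℕ) (hk : k + 1 ≤ T.K), 0 ≤ (steps k hk).P.starT
  /-- |T₁^{(k)*}| ≤ 3|T₁^{(k)}| (p. 260: T₁^{(k)*} ⊂ the bonds of the 3-torus T₁^{(k)}) -/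
  starT_le : ∀ (k : ℕ) (hk : k + 1 ≤ T.K), (steps k hk).P.starT ≤ 3 * T.sites k
  /-- |log σ₀| ≤ σmax (one group for the family) -/
  logσ₀_le : ∀ (k : ℕ) (hk : k + 1 ≤ T.K), |(steps k hk).P.logσ₀| ≤ C.σmax
  /-- d(𝔤) ≤ dg (one group for the family) -/
  dg_le : ∀ (k : ℕ) (hk : k + 1 ≤ T.K), (steps k hk).P.dg ≤ C.dg
  /-- |log Z^{(k)}(T₁^{(k)}, 1)| ≤ z|T₁^{(k)}| (p. 273, implicit) -/
  logZT_le : ∀ (k : ℕ) (hk : k + 1 ≤ T.K), |(steps k hk).P.logZT| ≤ C.z * T.sites k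
  /-- |Σ_X 𝒫′_{k+1}(g_k, X, 1)| ≤ aP|T₁^{(k)}| (p. 273 from (25)) -/
  PprT_le : ∀ (k : ℕ) (hk : k + 1 ≤ T.K), |(steps k hk).P.PprT| ≤ C.aP * T.sites k
  /-- the remainder unit of step k is (L^kε)^{3+κ₀}|T₁^{(k)}| (p. 262 / p. 269) -/
  rem_eq : ∀ (k : ℕ) (hk : k + 1 ≤ T.K), (steps k hk).P.rem = (C.L ^ k * ε) ^ (3 + C.κ₀) * T.sites k
  /-- (1) p. 256: no remainder term at k = 0 -/
  Rm_zero : T.Rm 0 ≤ 0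
  /-- the coefficient O((L^kε)^{3+κ₀}) of (41)_{k+1} is at most rstar -/
  Rm_succ_le : ∀ (k : ℕ) (hk : k + 1 ≤ T.K), T.Rm (k + 1) ≤ T.Rm k + C.rstar * (steps k hk).P.rem
  /-- pp. 273–274: the large-field histories with the Z-terms are controlled, constant d -/
  lf : ∀ k, k ≤ T.K → ∀ U : T.Cfg k,
    T.LF k U (fun h => -(T.mainT k h U) + T.Zterm k h) ≤ Real.exp (C.d * T.sites k)

variable {C : Consts} {T : TowerRun}

/-- `0 < g_k` along the run (p. 256: g > 0, ε > 0). [folklore] -/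
theorem LeafSystem.g_pos (S : LeafSystem C T) (k : ℕ) : 0 < T.g k := by
  rw [S.g_eq]
  exact gRun_pos C.g C.L S.ε C.g_pos (by linarith [C.one_lt_L]) S.ε_pos k

/-- Elementary: `|T₁^{(k)}| = (L^kε)^{−3}|T_ε| ≥ 0`. [folklore] -/
theorem sitesRun_nonneg (L ε Tε : ℝ) (hL : 0 < L) (hε : 0 < ε) (hT : 0 ≤ Tε) (k : ℕ) :
    0 ≤ sitesRun L ε Tε k := by
  unfold sitesRun; positivity

end LeafSystem

/-! ## 2. The three Sect. D constants from the leaves: interaction (46), counterterm (65), remainder (41) -/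

section SectDConstants

variable {C : Consts} {T : TowerRun}

/-- The interaction constant of Sect. D line 1 (p. 272 [18]: «We estimate the interaction terms using the bounds
(44)–(46) by O(1)M₁³g²_{k−1}p²(g_{k−1})|Λ_k| ≤ O(1)|T₁^{(k)}|»): `a = C46·M₁³·b₀²p₀^{2p₀}e^{2−2p₀}`
(`B10.gsq_psq_le`: g²p(g)² ≤ b₀²p₀^{2p₀}e^{2−2p₀} on (0, 1]). [cite: Balaban1985UV3, Sect. D p.272] -/
def aI (C : Consts) : ℝ := C.C46 * C.M₁ ^ 3 * (C.b₀ ^ 2 * (C.p₀ ^ (2 * C.p₀) * Real.exp (2 - 2 * C.p₀)))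

/-- Elementary: the interaction constant is ≥ 0. [folklore] -/
theorem aI_nonneg (C : Consts) : 0 ≤ aI C := by
  unfold aI
  have := C.C46_nonneg
  have := C.M₁_nonneg
  have := C.p₀_pos
  positivity

/-- Sect. D line 1 for a FAMILY sharing the constants: `|Σ_{j≤k}Σ_{Y_j}𝒫_j(Y_j, U_k)| ≤ a|T₁^{(k)}|` for ALL k ≤ K
(k = 0 by (1): no interaction terms), a = `aI C` the same for every run.  Re-derived
(`B10LargeField.interaction_uniform_of_46` + `interaction_all_steps`). [cite: Balaban1985UV3, Sect. D p.272] -/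
theorem pint_abs_le {I : Type} (T : I → TowerRun) (S : ∀ i, LeafSystem C (T i)) :
    ∀ i k, k ≤ (T i).K → ∀ (h : (T i).Hist k) (U : (T i).Cfg k),
      |(T i).Pint k h U| ≤ aI C * (T i).sites k :=
  interaction_all_steps T (fun i => (S i).noInt0) (aI C) (aI_nonneg C)
    (interaction_uniform_of_46 T C.C46 C.M₁ C.b₀ C.p₀ C.C46_nonneg C.M₁_nonneg C.p₀_pos
      (fun i => (S i).par) (fun i k hk1 hkK h U => (S i).bound46 k hk1 hkK h U)
      (fun i k hk => ⟨(S i).g_pos k, (S i).g_le_one k hk⟩) (fun i k h => (S i).Λvol_nonneg k h))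

/-- The g-INDEPENDENT part of the per-step counterterm bound: `a₁ = 3σmax + z + aP` (the terms log σ₀|T*|,
log Z^{(k)}(T, 1), Σ_X𝒫′ of (62) p. 271 [17]). [cite: Balaban1985UV3, (62) p.271] -/
def a₁ (C : Consts) : ℝ := 3 * C.σmax + C.z + C.aP

/-- Elementary: a₁ ≥ 0. [folklore] -/
theorem a₁_nonneg (C : Consts) : 0 ≤ a₁ C := by
  unfold a₁; linarith [C.σmax_nonneg, C.z_nonneg, C.aP_nonneg]

/-- **(62) ⇒ the per-step bound WITH THE LOG TERM** (p. 273 [19] «From (25), which holds for arbitrary j, we get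
easily |E^{(j)}| ≤ O(1)|T₁^{(j)}|» — what the four terms of (62) p. 271 [17] actually give, cell GAPS G-B10-01):
`|E^{(j)}| ≤ (a₁ + 3·dg·|log g_j|)|T₁^{(j)}|` for every j < K, from the leaf `Estep62` of step j and the (L5)
inputs, via `B10.Estep62_abs_le`.  Re-derived, kernel-checked. [cite: Balaban1985UV3, (62) p.271 + (65) p.273] -/
theorem LeafSystem.estep_abs_le (S : LeafSystem C T) (j : ℕ) (hj : j < T.K) :
    |T.Estep j| ≤ (a₁ C + (3 * C.dg) * |Real.log (T.g j)|) * T.sites j := by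
  have hj' : j + 1 ≤ T.K := hj
  have hE : T.Estep j = ((S.steps j hj').P.logσ₀ + (S.steps j hj').P.dg * Real.log (T.g j))
      * (S.steps j hj').P.starT + (S.steps j hj').P.logZT + (S.steps j hj').P.PprT := (S.steps j hj').estep62
  have h62 := Estep62_abs_le (S.steps j hj').P.logσ₀ (S.steps j hj').P.dg (Real.log (T.g j))
    (S.steps j hj').P.logZT (S.steps j hj').P.PprT (S.steps j hj').P.starT (T.sites j) C.aP C.z
    (S.steps j hj').P.dg_nonneg (S.starT_nonneg j hj') (S.starT_le j hj') (S.logZT_le j hj') (S.PprT_le j hj')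
  have hrw : T.Estep j = (S.steps j hj').P.logσ₀ * (S.steps j hj').P.starT
      + (S.steps j hj').P.dg * Real.log (T.g j) * (S.steps j hj').P.starT
      + (S.steps j hj').P.logZT + (S.steps j hj').P.PprT := by
    rw [hE]; ring
  rw [hrw]
  refine h62.trans (mul_le_mul_of_nonneg_right ?_ (T.sites_nonneg j))
  have h1 := S.logσ₀_le j hj'
  have h2 := S.dg_le j hj'
  have h3 : 0 ≤ |Real.log (T.g j)| := abs_nonneg _
  have h4 := mul_le_mul_of_nonneg_right h2 h3
  unfold a₁
  linarith

/-- The WINDOW-DEPENDENT counterterm constant of (65) p. 273 [19] (cell GAPS G-B10-01):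
`b(gmin, gmax) = (a₁ + 3dg·max(|log gmin|, |log gmax|))/(1 − L⁻³) + 3dg(½log L)L⁻³/(1 − L⁻³)²`.
[cite: Balaban1985UV3, (65) p.273] -/
def bW (C : Consts) (gmin gmax : ℝ) : ℝ :=
  (a₁ C + (3 * C.dg) * max |Real.log gmin| |Real.log gmax|) / (1 - (C.L ^ 3)⁻¹)
    + ((3 * C.dg) * (Real.log C.L / 2)) * ((C.L ^ 3)⁻¹ / (1 - (C.L ^ 3)⁻¹) ^ 2)

/-- **(64)–(65)** p. 273 [19] («E_k = Σ_{j=k}^{K−1} E^{(j)}», «|E_k| ≤ Σ_{k=k}^{K−1} ⟦sic: j = k⟧ O(1)|T₁^{(j)}| =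
Σ_{j=k}^{K−1} O(1)L^{−3(j−k)}|T₁^{(k)}| ≤ O(1)|T₁^{(k)}|») from the leaf system, WITH the log term: for `g_k ∈ [gmin, gmax]
⊂ (0, ∞)`,
`|E_k| ≤ b(gmin, gmax)|T₁^{(k)}|` (`B10.Ecst_abs_le_window`).  Re-derived, kernel-checked. [cite: Balaban1985UV3, (64)–(65) p.273] -/
theorem LeafSystem.ecst_abs_le (S : LeafSystem C T) {gmin gmax : ℝ} (hmin : 0 < gmin) (k : ℕ)
    (h1 : gmin ≤ T.g k) (h2 : T.g k ≤ gmax) : |T.Ecst k| ≤ bW C gmin gmax * T.sites k :=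
  Ecst_abs_le_window T C.g C.L S.ε S.Tε (a₁ C) (3 * C.dg) C.g_pos C.one_lt_L S.ε_pos S.Tε_nonneg
    (a₁_nonneg C) (by linarith [C.dg_nonneg]) S.g_eq S.sites_eq (fun j hj => S.estep_abs_le j hj)
    gmin gmax hmin k h1 h2

/-- Elementary: the remainder unit in terms of |T_ε|: `(L^kε)^{3+κ₀}|T₁^{(k)}| = (L^kε)^{κ₀}|T_ε|`. [folklore] -/
theorem remUnit_eq (L ε Tε κ₀ : ℝ) (hL : 0 < L) (hε : 0 < ε) (k : ℕ) :
    (L ^ k * ε) ^ (3 + κ₀) * sitesRun L ε Tε k = (L ^ k * ε) ^ κ₀ * Tε := by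
  have ht : 0 < L ^ k * ε := by positivity
  have h3 : (L ^ k * ε) ^ (3 + κ₀) = (L ^ k * ε) ^ (3 : ℕ) * (L ^ k * ε) ^ κ₀ := by
    rw [Real.rpow_add ht, show (3 : ℝ) = ((3 : ℕ) : ℝ) by norm_num, Real.rpow_natCast]
  unfold sitesRun
  rw [h3, inv_pow]
  field_simp

/-- **The remainder sum of (41)/(47) is O(1)|T₁^{(k)}|, uniformly** (pp. 266–267 [12–13] «Σ_{j=0}^{k−1}
O((L^jε)^{3+κ₀})|T₁^{(j)}|»): `Σ_{j<k} (L^jε)^{3+κ₀}|T₁^{(j)}| ≤ (L^{−κ₀}/(1 − L^{−κ₀}))·|T₁^{(k)}|` whenever `L^kε ≤ 1`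
(`B10.remainderSum_le` on the carrier scaling).  Re-derived, kernel-checked. [cite: Balaban1985UV3, (41) p.266] -/
theorem sum_remUnit_le (L ε Tε κ₀ : ℝ) (hL : 1 < L) (hε : 0 < ε) (hT : 0 ≤ Tε) (hκ : 0 < κ₀) (k : ℕ)
    (hk : L ^ k * ε ≤ 1) :
    ∑ j ∈ Finset.range k, (L ^ j * ε) ^ (3 + κ₀) * sitesRun L ε Tε j
      ≤ ((L ^ κ₀)⁻¹ / (1 - (L ^ κ₀)⁻¹)) * sitesRun L ε Tε k := by
  have hL0 : 0 < L := by linarith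
  have hrw : ∀ j, (L ^ j * ε) ^ (3 + κ₀) * sitesRun L ε Tε j = (L ^ j * ε) ^ κ₀ * Tε :=
    fun j => remUnit_eq L ε Tε κ₀ hL0 hε j
  simp_rw [hrw]
  rw [← Finset.sum_mul]
  have hsum := remainderSum_le L ε κ₀ hL hε hκ k
  have hLκ : 1 < L ^ κ₀ := Real.one_lt_rpow hL hκ
  have hq1 : (L ^ κ₀)⁻¹ < 1 := inv_lt_one_of_one_lt₀ hLκ
  have hq0 : 0 ≤ (L ^ κ₀)⁻¹ := by positivity
  have hQ : 0 ≤ (L ^ κ₀)⁻¹ / (1 - (L ^ κ₀)⁻¹) := div_nonneg hq0 (by linarith)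
  have ht : 0 < L ^ k * ε := by positivity
  have hpow_le : (L ^ k * ε) ^ (3 + κ₀) ≤ 1 := Real.rpow_le_one ht.le hk (by linarith)
  have hs : 0 ≤ sitesRun L ε Tε k := sitesRun_nonneg L ε Tε hL0 hε hT k
  calc (∑ j ∈ Finset.range k, (L ^ j * ε) ^ κ₀) * Tε
      ≤ ((L ^ k * ε) ^ κ₀ * ((L ^ κ₀)⁻¹ / (1 - (L ^ κ₀)⁻¹))) * Tε := mul_le_mul_of_nonneg_right hsum hT
    _ = ((L ^ κ₀)⁻¹ / (1 - (L ^ κ₀)⁻¹)) * ((L ^ k * ε) ^ (3 + κ₀) * sitesRun L ε Tε k) := by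
        rw [remUnit_eq L ε Tε κ₀ hL0 hε k]; ring
    _ ≤ ((L ^ κ₀)⁻¹ / (1 - (L ^ κ₀)⁻¹)) * (1 * sitesRun L ε Tε k) :=
        mul_le_mul_of_nonneg_left (mul_le_mul_of_nonneg_right hpow_le hs) hQ
    _ = ((L ^ κ₀)⁻¹ / (1 - (L ^ κ₀)⁻¹)) * sitesRun L ε Tε k := by ring

/-- The remainder constant of Sect. D: `c = rstar·L^{−κ₀}/(1 − L^{−κ₀})`. [cite: Balaban1985UV3, (41) p.266] -/
def cR (C : Consts) : ℝ := C.rstar * ((C.L ^ C.κ₀)⁻¹ / (1 - (C.L ^ C.κ₀)⁻¹))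

/-- The remainder term of (41)_k accumulated from the step rates: `Rm k ≤ rstar·Σ_{j<k}(L^jε)^{3+κ₀}|T₁^{(j)}|` for
k ≤ K (induction on k over `Rm_zero`, `Rm_succ_le`, `rem_eq`).  Re-derived. [cite: Balaban1985UV3, (41) p.266] -/
theorem LeafSystem.Rm_le_sum (S : LeafSystem C T) :
    ∀ k, k ≤ T.K → T.Rm k ≤ C.rstar * ∑ j ∈ Finset.range k, (C.L ^ j * S.ε) ^ (3 + C.κ₀) * T.sites j := by
  intro k
  induction k with
  | zero => intro _; simpa using S.Rm_zero
  | succ k ih =>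
    intro hk
    have h1 := S.Rm_succ_le k hk
    rw [S.rem_eq k hk] at h1
    have h2 := ih (by omega)
    rw [Finset.sum_range_succ, mul_add]
    linarith

/-- **The remainder term is O(1)|T₁^{(k)}| with c = `cR C`, the same for every run and every k ≤ K** (this is
where `L^kε ≤ ε₀ ≤ 1` is used).  Re-derived, kernel-checked. [cite: Balaban1985UV3, (41) p.266 + Sect. D p.272] -/
theorem LeafSystem.Rm_le (S : LeafSystem C T) (k : ℕ) (hk : k ≤ T.K) : T.Rm k ≤ cR C * T.sites k := by
  have h1 := S.Rm_le_sum k hk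
  have h2 := sum_remUnit_le C.L S.ε S.Tε C.κ₀ C.one_lt_L S.ε_pos S.Tε_nonneg C.κ₀_pos k (S.scale_le_one k hk)
  simp_rw [← S.sites_eq] at h2
  have h3 := mul_le_mul_of_nonneg_left h2 C.rstar_nonneg
  unfold cR
  linarith

end SectDConstants

/-! ## 3. The assembly: leaf systems with common constants ⇒ Theorem 2 ∧ Theorem 1 (compact reading) -/

section Assembly

variable {C : Consts}

/-- **Theorem 2** (p. 272 [18]: «The sequence of densities ρ_k defined by the inductive equations (2), with ρ₀ given
by (1), satisfies the inequalities (41), (47).») for a family of runs each carrying a leaf system: (1)₀ + the step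
leaves for every k < K (`B10SectAGathering.thm2_of_leaves`).  Re-derived bookkeeping; every leaf a hypothesis.
[cite: Balaban1985UV3, Thm 2 p.272] -/
theorem thm2_of_leafSystem {I : Type} (T : I → TowerRun) (S : ∀ i, LeafSystem C (T i)) :
    Thm2Printed (fun i => (T i).toRunData) :=
  thm2_of_leaves T (fun i => (S i).spec) (fun i => (S i).step0)
    (fun i k hk => ⟨(S i).g_pos k, (S i).g_le_one k (by omega)⟩) (fun i k hk => (S i).steps k hk)

/-- **The O(1) of (5) DISPLAYED**: `O(1)(gmin, gmax) = a + b(gmin, gmax) + c + d` with `a = aI C` (interaction,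
(46) + Sect. D line 1), `b = bW C gmin gmax` (counterterm, (62)/(64)/(65) with the d(𝔤) log g_k term — the ONLY
window dependence), `c = cR C` (remainder), `d = C.d` (large fields) — independent of ε, of k and of the run, as the
uniformity sentence of Theorem 1 (p. 257 [3] l. 1 «and the constant O(1) is independent of ε, k, g_k in a bounded
set») requires under the audit reading "bounded set" = compact subset of (0, ∞) (cell GAPS G-B10-01).
[cite: Balaban1985UV3, (5) p.256 + Thm 1 p.257] -/
def O1 (C : Consts) (gmin gmax : ℝ) : ℝ := aI C + bW C gmin gmax + cR C + C.d

/-- **(5) at every step whose coupling lies in the window**, for every run of the family, with the displayed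
constant: Theorem 2 gives (41)_k ∧ (47)_k, and Sect. D's four piece-bounds (`pint_abs_le`, `LeafSystem.ecst_abs_le`,
`LeafSystem.Rm_le`, the leaf `lf`) feed `B10.bounds5At_of_ineqs`.  Re-derived bookkeeping, kernel-checked.
(Why not through `B10.thm1Compact_of_thm2` / `B10LargeField.thm1Compact_of_thm2_leaves`: their hypothesis `hE`
quantifies the window over ALL real gmin, also gmin ≤ 0, i.e. it asks for a counterterm bound uniform on (0, gmax],
which the leaves cannot supply for a family containing arbitrarily fine lattices — the d(𝔤) log g_k term again,
G-B10-01; those two theorems are correct but their `hE` is not dischargeable from print, so the compact reading is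
re-derived here from `B10.bounds5At_of_ineqs` under `0 < gmin` only, exactly as `B10.Thm1PrintedCompact` is
quantified.) [cite: Balaban1985UV3, (5) p.256 + Sect. D pp.272–274] -/
theorem bounds5_of_leafSystem {I : Type} (T : I → TowerRun) (S : ∀ i, LeafSystem C (T i))
    {gmin gmax : ℝ} (hmin : 0 < gmin) (i : I) (k : ℕ) (hk : k ≤ (T i).K)
    (h1 : gmin ≤ (T i).g k) (h2 : (T i).g k ≤ gmax) :
    Bounds5At (T i).toRunData (O1 C gmin gmax) k := by
  have h4147 := ((S i).spec k).mp (thm2_of_leafSystem T S i k hk)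
  exact bounds5At_of_ineqs (T i) k (aI C) (bW C gmin gmax) (cR C) C.d C.d_nonneg h4147.1 h4147.2
    (pint_abs_le T S i k hk) ((S i).ecst_abs_le hmin k h1 h2) ((S i).Rm_le k hk) ((S i).lf k hk)

/-- **Theorem 1, audit reading** (p. 257 [3]: «The lattice approximations of the three-dimensional pure Yang–Mills
theory with a semi-simple compact group Lie G are ultraviolet stable in the sense that the sequence of densities ρ_k,
constructed by the inductive definition (2), with ρ₀ given by (1), satisfies the bounds (5).», with «the constant
O(1) is independent of ε, k, g_k in a bounded set» read as a compact window; `B10.Thm1PrintedCompact`) for every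
family of runs carrying leaf systems with common constants.  Re-derived bookkeeping, kernel-checked; value = the
architecture of the paper certified modulo the located leaves, NOT a proof of the leaves. [cite: Balaban1985UV3, Thm 1 p.257] -/
theorem thm1Compact_of_leafSystem {I : Type} (T : I → TowerRun) (S : ∀ i, LeafSystem C (T i)) :
    Thm1PrintedCompact (fun i => (T i).toRunData) := fun gmin gmax hmin _ =>
  ⟨O1 C gmin gmax, fun i k hk h1 h2 => bounds5_of_leafSystem T S hmin i k hk h1 h2⟩

/-- **THE PAPER AS ONE IMPLICATION**: leaf systems with common constants ⇒ Theorem 1 (compact reading) ∧ Theorem 2.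
(The cell's DAG node `DagBinding` conjoins `B10.Thm1Printed ∧ B10.Thm2Printed`; the one-sided `Thm1Printed` is NOT
derivable from the printed leaves — G-B10-01, `B10.thm1Compact_of_thm1Printed` goes one way only — so this is the
strongest form the print supports.) [cite: Balaban1985UV3, Thm 1 p.257 + Thm 2 p.272] -/
theorem thm1Compact_and_thm2_of_leafSystem {I : Type} (T : I → TowerRun) (S : ∀ i, LeafSystem C (T i)) :
    Thm1PrintedCompact (fun i => (T i).toRunData) ∧ Thm2Printed (fun i => (T i).toRunData) :=
  ⟨thm1Compact_of_leafSystem T S, thm2_of_leafSystem T S⟩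

end Assembly


/-! ## 4. The cumulant remainder of (24)/(58) in its RAW printed form, discharged to the leaf shape (k-free) -/

section RawRemainder

variable {T : TowerRun} {k : ℕ}

/-- LEAF (24)/(58) with the remainder IN ITS RAW PRINTED FORM.  k = 0: pp. 261–262 [7–8] «Using the ideas and
methods of [11, 12, 8, 9] we expand v(g₀A) − 1/g₀²Ṽ(g₀A) up to the sixth order (or higher) in g₀, and we estimate
the remainder by O(g₀⁷p¹⁸(g₀))|Ω₁| ≤ O(ε^{3+κ₀})|T₁|, κ₀ > 0.» (χ = Π_{b∈Ω₁}χ({|A(b)| < p²(g₀)}), p. 261); k ≥ 1: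
p. 269 [15] «Now we repeat again the operations of the first step. We expand the functions in the last exponential
above up to the sixth order in g_k, and we estimate the remainder. … The remainders for both expressions are
estimated by O(g⁷p¹⁸(g_k))|B(Λ_{k+1})| ≤ O((L^kε)^{3+κ₀})|T₁^{(k)}|.»  Typed: the cumulant bound of
`B10SectAGathering.Cumulant58` ((24) p. 262 / (58)–(59) p. 270 with the O(g_k)|Z_k| terms) with last term
`Craw · g_k⁷ p(g_k)^18 · vol h` (vol h = |Ω₁| resp. |B(Λ_{k+1})|, a history-dependent volume ≤ |T₁^{(k)}|) in
place of `C · rem`.  A leaf, not a claim. [cite: Balaban1985UV3, pp.261–262 + p.269 + (58) p.270] -/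
def Cumulant58Raw (P : StepPieces T k) (Cz Craw : ℝ) (vol : T.Hist (k + 1) → ℝ) : Prop :=
  ∀ (h : T.Hist (k + 1)) (U : T.Cfg (k + 1)),
    P.logFl h U ≤ P.PprU h U + Cz * T.g k * P.Zvol h
      + Craw * (T.g k ^ 7 * pFun T.b₀ T.p₀ (T.g k) ^ 18) * vol h

/-- The k-FREE, ε-FREE constant in front of (L^kε)^{3+κ₀}|T₁^{(k)}| produced by the printed power counting
(`B10SectAGathering.remainder_powerCounting` with q = 18p₀, m = 18):
`Craw·b₀¹⁸·g^{6+2κ₀}·(18p₀/(1 − 2κ₀))^{18p₀}e^{1−2κ₀−18p₀}`. [cite: Balaban1985UV3, p.262 + p.269] -/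
def rawConst (Craw b₀ p₀ g κ₀ : ℝ) : ℝ :=
  Craw * b₀ ^ 18 * (g ^ (6 + 2 * κ₀)
    * (((18 * p₀) / (1 - 2 * κ₀)) ^ (18 * p₀) * Real.exp ((1 - 2 * κ₀) - 18 * p₀)))

/-- **The printed «≤» of p. 262 / p. 269 discharged at the level of the leaf**: the raw remainder
`O(g_k⁷p¹⁸(g_k))·vol` with `vol ≤ |T₁^{(k)}|`, `g_k = g(L^kε)^{1/2} ≤ 1`, `0 < κ₀ < ½` is at most
`rawConst · (L^kε)^{3+κ₀}|T₁^{(k)}|`, so `Cumulant58Raw P Cz Craw vol → Cumulant58 P Cz (rawConst Craw b₀ p₀ g κ₀)`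
— with a constant independent of k and ε, which is what the k-uniformity of Theorem 2's leaves requires (gen-6
owed item (α) of the cell HANDOFF).  Re-derived, kernel-checked. [cite: Balaban1985UV3, (24) p.262 + (58) p.270] -/
theorem cumulant58_of_raw (P : StepPieces T k) {Cz Craw : ℝ} {vol : T.Hist (k + 1) → ℝ}
    (g L ε κ₀ : ℝ) (hg : 0 < g) (hL : 0 < L) (hε : 0 < ε) (hκ : κ₀ < 1 / 2)
    (hp₀ : 0 < T.p₀) (hb₀ : 0 ≤ T.b₀) (hC : 0 ≤ Craw)
    (hgk : T.g k = gRun g L ε k) (hgk1 : T.g k ≤ 1)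
    (hvol0 : ∀ h, 0 ≤ vol h) (hvol : ∀ h, vol h ≤ T.sites k)
    (hrem : P.rem = (L ^ k * ε) ^ (3 + κ₀) * T.sites k)
    (h : Cumulant58Raw P Cz Craw vol) :
    Cumulant58 P Cz (rawConst Craw T.b₀ T.p₀ g κ₀) := by
  intro h' U
  have hgpos : 0 < T.g k := by rw [hgk]; exact gRun_pos g L ε hg hL hε k
  have hp := pFun_pow T.b₀ T.p₀ (T.g k) 18 hgpos hgk1
  rw [show ((18 : ℕ) : ℝ) * T.p₀ = 18 * T.p₀ by norm_num] at hp
  have hq : 0 < (18 : ℝ) * T.p₀ := by positivity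
  have hgk1' : gRun g L ε k ≤ 1 := by rw [← hgk]; exact hgk1
  have hpc := remainder_powerCounting g L ε κ₀ (18 * T.p₀) Craw T.b₀ 18 k (vol h') (T.sites k)
    hg hL hε hκ hq hC hb₀ hgk1' (hvol0 h') (hvol h')
  rw [← hgk] at hpc
  have hraw := h h' U
  rw [hp] at hraw
  have hassoc : Craw * (T.g k ^ 7 * (T.b₀ ^ 18 * (1 + Real.log (T.g k)⁻¹) ^ (18 * T.p₀))) * vol h'
      = Craw * T.g k ^ 7 * (T.b₀ ^ 18 * (1 + Real.log (T.g k)⁻¹) ^ (18 * T.p₀)) * vol h' := by ring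
  unfold rawConst
  rw [hrem]
  linarith [hpc, hassoc]

end RawRemainder

/-! ## 4b. (v1.1) Three more remainder leaves in RAW printed form — the representation (33)/(60), the log-Z
decomposition (35)/(61), the lower cumulant direction (37)/(47) — discharged to the leaf shapes with k-, ε-free
constants; the remainder coefficient of (41)/(47) displayed -/

section RawRemainder2

variable {T : TowerRun} {k : ℕ}

/-- The k-FREE, ε-FREE constant in front of (L^kε)^{3+κ₀}|T₁^{(k)}| produced by the printed power counting for a raw
remainder carrying `g_k⁷(r(g_k)p(g_k))⁷ = g_k⁷ b₀⁷ (1 + log g_k⁻¹)^{7(r₀+p₀)}` (`B10SectAGathering.rFun_mul_pFun_pow`,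
`B10SectAGathering.remainder_powerCounting` with q = 7(r₀ + p₀), m = 7):
`Craw·b₀⁷·g^{6+2κ₀}·(7(r₀+p₀)/(1 − 2κ₀))^{7(r₀+p₀)}e^{1−2κ₀−7(r₀+p₀)}`. [cite: Balaban1985UV3, (28)–(30) p.263 + (60) p.271] -/
def rawConst7 (Craw b₀ r₀ p₀ g κ₀ : ℝ) : ℝ :=
  Craw * b₀ ^ 7 * (g ^ (6 + 2 * κ₀)
    * (((7 * (r₀ + p₀)) / (1 - 2 * κ₀)) ^ (7 * (r₀ + p₀)) * Real.exp ((1 - 2 * κ₀) - 7 * (r₀ + p₀))))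

/-- Elementary (the power counting of `B10SectAGathering.remainder_powerCounting` at q = 18p₀, m = 18, along the run,
`B10SectAGathering.pFun_pow`): `Craw·g_k⁷p¹⁸(g_k)·vol ≤ rawConst·(L^kε)^{3+κ₀}|T₁^{(k)}|` for `0 ≤ vol ≤ |T₁^{(k)}|`,
`g_k = g(L^kε)^{1/2} ≤ 1`, `κ₀ < ½`, `p₀ > 0`, `b₀, Craw ≥ 0` — the arithmetic inside `cumulant58_of_raw`, isolated.
[folklore] -/
theorem raw18_le (Craw vol g L ε κ₀ : ℝ) (hg : 0 < g) (hL : 0 < L) (hε : 0 < ε) (hκ : κ₀ < 1 / 2)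
    (hp₀ : 0 < T.p₀) (hb₀ : 0 ≤ T.b₀) (hC : 0 ≤ Craw) (hgk : T.g k = gRun g L ε k) (hgk1 : T.g k ≤ 1)
    (hvol0 : 0 ≤ vol) (hvol : vol ≤ T.sites k) :
    Craw * (T.g k ^ 7 * pFun T.b₀ T.p₀ (T.g k) ^ 18) * vol
      ≤ rawConst Craw T.b₀ T.p₀ g κ₀ * ((L ^ k * ε) ^ (3 + κ₀) * T.sites k) := by
  have hgpos : 0 < T.g k := by rw [hgk]; exact gRun_pos g L ε hg hL hε k
  have hp := pFun_pow T.b₀ T.p₀ (T.g k) 18 hgpos hgk1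
  rw [show ((18 : ℕ) : ℝ) * T.p₀ = 18 * T.p₀ by norm_num] at hp
  have hq : 0 < (18 : ℝ) * T.p₀ := by positivity
  have hgk1' : gRun g L ε k ≤ 1 := by rw [← hgk]; exact hgk1
  have hpc := remainder_powerCounting g L ε κ₀ (18 * T.p₀) Craw T.b₀ 18 k vol (T.sites k)
    hg hL hε hκ hq hC hb₀ hgk1' hvol0 hvol
  rw [← hgk] at hpc
  rw [hp]
  have hassoc : Craw * (T.g k ^ 7 * (T.b₀ ^ 18 * (1 + Real.log (T.g k)⁻¹) ^ (18 * T.p₀))) * vol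
      = Craw * T.g k ^ 7 * (T.b₀ ^ 18 * (1 + Real.log (T.g k)⁻¹) ^ (18 * T.p₀)) * vol := by ring
  unfold rawConst
  linarith [hpc, hassoc]

/-- Elementary (the power counting of `B10SectAGathering.remainder_powerCounting` at q = 7(r₀ + p₀), m = 7, along the
run, `B10SectAGathering.rFun_mul_pFun_pow`): `Craw·g_k⁷(r(g_k)p(g_k))⁷·vol ≤ rawConst7·(L^kε)^{3+κ₀}|T₁^{(k)}|` for
`0 ≤ vol ≤ |T₁^{(k)}|`, `g_k = g(L^kε)^{1/2} ≤ 1`, `κ₀ < ½`, `r₀ ≥ 0`, `p₀ > 0`, `b₀, Craw ≥ 0`. [folklore] -/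
theorem raw7_le (Craw r₀ vol g L ε κ₀ : ℝ) (hg : 0 < g) (hL : 0 < L) (hε : 0 < ε) (hκ : κ₀ < 1 / 2)
    (hr₀ : 0 ≤ r₀) (hp₀ : 0 < T.p₀) (hb₀ : 0 ≤ T.b₀) (hC : 0 ≤ Craw) (hgk : T.g k = gRun g L ε k)
    (hgk1 : T.g k ≤ 1) (hvol0 : 0 ≤ vol) (hvol : vol ≤ T.sites k) :
    Craw * (T.g k ^ 7 * (rFun r₀ (T.g k) * pFun T.b₀ T.p₀ (T.g k)) ^ 7) * vol
      ≤ rawConst7 Craw T.b₀ r₀ T.p₀ g κ₀ * ((L ^ k * ε) ^ (3 + κ₀) * T.sites k) := by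
  have hgpos : 0 < T.g k := by rw [hgk]; exact gRun_pos g L ε hg hL hε k
  have hrp := rFun_mul_pFun_pow r₀ T.b₀ T.p₀ (T.g k) 7 hgpos hgk1
  rw [show ((7 : ℕ) : ℝ) * (r₀ + T.p₀) = 7 * (r₀ + T.p₀) by norm_num] at hrp
  have hq : 0 < 7 * (r₀ + T.p₀) := by linarith
  have hgk1' : gRun g L ε k ≤ 1 := by rw [← hgk]; exact hgk1
  have hpc := remainder_powerCounting g L ε κ₀ (7 * (r₀ + T.p₀)) Craw T.b₀ 7 k vol (T.sites k)
    hg hL hε hκ hq hC hb₀ hgk1' hvol0 hvol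
  rw [← hgk] at hpc
  rw [hrp]
  have hassoc : Craw * (T.g k ^ 7 * (T.b₀ ^ 7 * (1 + Real.log (T.g k)⁻¹) ^ (7 * (r₀ + T.p₀)))) * vol
      = Craw * T.g k ^ 7 * (T.b₀ ^ 7 * (1 + Real.log (T.g k)⁻¹) ^ (7 * (r₀ + T.p₀))) * vol := by ring
  unfold rawConst7
  linarith [hpc, hassoc]

/-- LEAF (33)/(60) with the remainder IN RAW FORM.  k = 0: p. 263 [9] «and we expand the function with respect to 𝓗(B).
Because of the bound (28) it is enough to expand up to the sixth order, hence (30) 𝒫′₁(g₀, X, exp i𝓗(B)) = 𝒫′₁(g₀, X, 1)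
+ ⟨((δ/δ𝓗)𝒫′₁)(g₀, X, 1), 𝓗(B)⟩ + Σ_{n=2}^6 (1/n!)⟨((δⁿ/δ𝓗ⁿ)𝒫′₁)(g₀, X, 1), ⊗ⁿ𝓗(B)⟩ + O(g₀⁷)e^{−κ𝓛(X)}» (with (28)
«|B(c)| < 4L²|c₋ − y|g₀p(g₀) < 8L²3R₁M₁r(g₀)g₀p(g₀)»), p. 264 [10] «We expand it up to the sixth order at most, and we
estimate remainders by the last term in (30). … We use the remaining exp(−κ₁𝓛(X)) to control a sum over all X
contributing to a given monomial in variables B. Thus we obtain the following very simple representation (33) Σ_X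
𝒫′₁(g₀, X, U₁) = Σ_X 𝒫′₁(g₀, X, 1) + Σ_Y 𝒫₁(g₀, Y, U₁) + O(ε^{3+κ₀})|T₁|»; k ≥ 1: p. 271 [17] «We expand the function
𝒫′_{k+1}(g_k, X, exp iη𝓗(B)) with respect to 𝓗(B) at first, up to the sixth order, so we have the formula (30) (for
η-scale). … Summing up terms with the same monomial in B yields the following analog of (33), (60) Σ_X 𝒫′_{k+1}(g_k,
X, U_{k+1}) = Σ_X 𝒫′_{k+1}(g_k, X, 1) + Σ_{Y_{k+1}} 𝒫_{k+1}(g_k, Y_{k+1}, U_{k+1}) + O((L^kε)^{3+κ₀})|T₁^{(k)}|».  Typed: the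
two-sided bound of `B10SectAGathering.Repr33_60` with, in place of `C·rem`, the last term of (30) in the cell's
EXPLICIT shape — `B10SectAGathering.remainder30_le` (gen 6): `≤ 2·MX·(48B₃L²R₁M₁/ρ)⁷·(r(g₀)p(g₀))⁷·g₀⁷`, MX = the sup
of |𝒫′₁(g₀, X, ·)| = O(g₀)e^{−κ𝓛(X)} by (25), one power of g₀ ≤ 1 given away — summed over the localizations:
`Craw · g_k⁷(r(g_k)p(g_k))⁷ · vol h` (vol h = the number of big blocks of Ω₁ resp. Ω_{k+1} carrying Σ_X e^{−κ𝓛(X)},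
≤ |T₁^{(k)}|; r₀ = the exponent of r(g) of p. 257, free in print — cell GAPS G-B10-02; (30)'s radius ρ — G-B10-04).
The print displays no intermediate raw bound here (it does for (24)): the shape is the cell's reading of «we estimate
remainders by the last term in (30)» + «control a sum over all X».  A leaf, not a claim.
[cite: Balaban1985UV3, (28)–(30) p.263 + (33) p.264 + (60) p.271] -/
def Repr33_60Raw (P : StepPieces T k) (Craw r₀ : ℝ) (vol : T.Hist (k + 1) → ℝ) : Prop :=
  ∀ (h : T.Hist (k + 1)) (U : T.Cfg (k + 1)),
    |P.PprU h U - (P.Ppr1 h + P.PY h U)|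
      ≤ Craw * (T.g k ^ 7 * (rFun r₀ (T.g k) * pFun T.b₀ T.p₀ (T.g k)) ^ 7) * vol h

/-- **The printed «+ O(ε^{3+κ₀})|T₁|» of (33) / «+ O((L^kε)^{3+κ₀})|T₁^{(k)}|» of (60) discharged at the level of the
leaf**: `Repr33_60Raw P Craw r₀ vol → Repr33_60 P (rawConst7 Craw b₀ r₀ p₀ g κ₀)` for `vol ≤ |T₁^{(k)}|`,
`g_k = g(L^kε)^{1/2} ≤ 1`, `0 < κ₀ < ½` — a constant independent of k and ε (gen-7 owed item (α′) of the cell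
HANDOFF).  Re-derived, kernel-checked (`raw7_le`). [cite: Balaban1985UV3, (33) p.264 + (60) p.271] -/
theorem repr33_60_of_raw (P : StepPieces T k) {Craw r₀ : ℝ} {vol : T.Hist (k + 1) → ℝ}
    (g L ε κ₀ : ℝ) (hg : 0 < g) (hL : 0 < L) (hε : 0 < ε) (hκ : κ₀ < 1 / 2)
    (hr₀ : 0 ≤ r₀) (hp₀ : 0 < T.p₀) (hb₀ : 0 ≤ T.b₀) (hC : 0 ≤ Craw)
    (hgk : T.g k = gRun g L ε k) (hgk1 : T.g k ≤ 1)
    (hvol0 : ∀ h, 0 ≤ vol h) (hvol : ∀ h, vol h ≤ T.sites k)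
    (hrem : P.rem = (L ^ k * ε) ^ (3 + κ₀) * T.sites k)
    (h : Repr33_60Raw P Craw r₀ vol) :
    Repr33_60 P (rawConst7 Craw T.b₀ r₀ T.p₀ g κ₀) := by
  intro h' U
  rw [hrem]
  exact (h h' U).trans
    (raw7_le Craw r₀ (vol h') g L ε κ₀ hg hL hε hκ hr₀ hp₀ hb₀ hC hgk hgk1 (hvol0 h') (hvol h'))

/-- LEAF (35)/(61) with the remainder IN RAW FORM.  k = 0: p. 265 [11] «The term log Z^{(0)}(Ω₁, U₁) − log Z^{(0)}(Ω₁, 1)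
can be decomposed in a similar way as the integral in (24), and we get an expression Σ_Y 𝒫₁(Y, U₁) which is identical
to the expression on the right-hand side of (33), only the coefficients do not depend on g₀.»; k ≥ 1: p. 271 [17]
«To complete the proof of the inductive assumption (41) we have to expand the term (61) analogously to (60). It can be
localized in a similar way, although a bit more complicated, as the perturbative expressions.»  Typed: the bound of
`B10SectAGathering.Decomp35_61` with the same raw last term as `Repr33_60Raw` — «analogously to (60)»: the expansion
(30) in 𝓗(B) of the localized pieces of the log-determinant (sup MX = O(1)e^{−κ𝓛(X)} with g-independent
coefficients; the seventh power of |𝓗(B)| ≤ B₃·8L²3R₁M₁r(g_k)g_kp(g_k) alone gives g_k⁷(r(g_k)p(g_k))⁷):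
`Craw · g_k⁷(r(g_k)p(g_k))⁷ · vol h`.  By analogy only — the print displays no remainder for (61); the operator calculus
of (63) pp. 271–272 is kernel-checked in `…B10LogDet63`, the walk-locality leaf is cell GAPS G-B10-06.  A leaf, not a
claim. [cite: Balaban1985UV3, (35) p.265 + (61) p.271] -/
def Decomp35_61Raw (P : StepPieces T k) (Craw r₀ : ℝ) (vol : T.Hist (k + 1) → ℝ) : Prop :=
  ∀ (h : T.Hist (k + 1)) (U : T.Cfg (k + 1)),
    |P.logZU h U - P.logZ1 h - P.PYZ h U|
      ≤ Craw * (T.g k ^ 7 * (rFun r₀ (T.g k) * pFun T.b₀ T.p₀ (T.g k)) ^ 7) * vol h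

/-- **The remainder of the (61)-expansion («analogously to (60)») discharged at the level of the leaf**:
`Decomp35_61Raw P Craw r₀ vol → Decomp35_61 P (rawConst7 Craw b₀ r₀ p₀ g κ₀)` for `vol ≤ |T₁^{(k)}|`,
`g_k = g(L^kε)^{1/2} ≤ 1`, `0 < κ₀ < ½` — a constant independent of k and ε (gen-7 owed item (α′)).  Re-derived,
kernel-checked (`raw7_le`). [cite: Balaban1985UV3, (35) p.265 + (61) p.271] -/
theorem decomp35_61_of_raw (P : StepPieces T k) {Craw r₀ : ℝ} {vol : T.Hist (k + 1) → ℝ}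
    (g L ε κ₀ : ℝ) (hg : 0 < g) (hL : 0 < L) (hε : 0 < ε) (hκ : κ₀ < 1 / 2)
    (hr₀ : 0 ≤ r₀) (hp₀ : 0 < T.p₀) (hb₀ : 0 ≤ T.b₀) (hC : 0 ≤ Craw)
    (hgk : T.g k = gRun g L ε k) (hgk1 : T.g k ≤ 1)
    (hvol0 : ∀ h, 0 ≤ vol h) (hvol : ∀ h, vol h ≤ T.sites k)
    (hrem : P.rem = (L ^ k * ε) ^ (3 + κ₀) * T.sites k)
    (h : Decomp35_61Raw P Craw r₀ vol) :
    Decomp35_61 P (rawConst7 Craw T.b₀ r₀ T.p₀ g κ₀) := by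
  intro h' U
  rw [hrem]
  exact (h h' U).trans
    (raw7_le Craw r₀ (vol h') g L ε κ₀ hg hL hε hκ hr₀ hp₀ hb₀ hC hgk hgk1 (hvol0 h') (hvol h'))

/-- LEAF (the lower cumulant direction at the trivial history, for (37)/(47)) with the remainder IN RAW FORM: p. 265
[11] «we perform the same operations on the whole lattice as on the sets Ω₁. They give the inequality (37)»; p. 272
[18] «The lower bound is proved in the same way» — so its remainder is that of (24)/(58) on the whole lattice,
pp. 261–262 [7–8] «we estimate the remainder by O(g₀⁷p¹⁸(g₀))|Ω₁| ≤ O(ε^{3+κ₀})|T₁|, κ₀ > 0», p. 269 [15] «The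
remainders for both expressions are estimated by O(g⁷p¹⁸(g_k))|B(Λ_{k+1})| ≤ O((L^kε)^{3+κ₀})|T₁^{(k)}|».  Typed:
`B10SectAGathering.CumulantLower` with `Craw·g_k⁷p¹⁸(g_k)·vol` (vol = |T₁^{(k)}| at the trivial history; typed
`0 ≤ vol ≤ |T₁^{(k)}|`) in place of `C·rem`.  A leaf, not a claim. [cite: Balaban1985UV3, (37) p.265 + p.272 + p.262 + p.269] -/
def CumulantLowerRaw (P : StepPieces T k) (Craw vol : ℝ) : Prop :=
  ∀ U : T.Cfg (k + 1),
    P.PprU (T.triv (k + 1)) U - Craw * (T.g k ^ 7 * pFun T.b₀ T.p₀ (T.g k) ^ 18) * vol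
      ≤ P.logFl (T.triv (k + 1)) U

/-- **The printed «≤» of p. 262 / p. 269 discharged for the lower direction**: `CumulantLowerRaw P Craw vol →
CumulantLower P (rawConst Craw b₀ p₀ g κ₀)` for `vol ≤ |T₁^{(k)}|`, `g_k = g(L^kε)^{1/2} ≤ 1`, `0 < κ₀ < ½` — the same
k-, ε-free constant as `cumulant58_of_raw`.  Re-derived, kernel-checked (`raw18_le`). [cite: Balaban1985UV3, (37) p.265 + p.272] -/
theorem cumulantLower_of_raw (P : StepPieces T k) {Craw vol : ℝ}
    (g L ε κ₀ : ℝ) (hg : 0 < g) (hL : 0 < L) (hε : 0 < ε) (hκ : κ₀ < 1 / 2)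
    (hp₀ : 0 < T.p₀) (hb₀ : 0 ≤ T.b₀) (hC : 0 ≤ Craw)
    (hgk : T.g k = gRun g L ε k) (hgk1 : T.g k ≤ 1)
    (hvol0 : 0 ≤ vol) (hvol : vol ≤ T.sites k)
    (hrem : P.rem = (L ^ k * ε) ^ (3 + κ₀) * T.sites k)
    (h : CumulantLowerRaw P Craw vol) :
    CumulantLower P (rawConst Craw T.b₀ T.p₀ g κ₀) := by
  intro U
  rw [hrem]
  linarith [h U, raw18_le Craw vol g L ε κ₀ hg hL hε hκ hp₀ hb₀ hC hgk hgk1 hvol0 hvol]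

/-- **The remainder coefficient of (41)/(47), DISPLAYED** ((41) p. 266 [12] «+ Σ_{j=0}^{k−1} O((Lʲε)^{3+κ₀})|T₁^{(j)}|»;
Theorem 1 p. 257 [3] «and the constant O(1) is independent of ε, k, g_k in a bounded set»).  The step bookkeeping
`B10SectAGathering.StepLeaves` books the coefficient of step k as `max C₁ C₁' + C₂ + C₃ + C₄` (field `rmSucc`), the
constants of the leaves `Cumulant58` / `CumulantLower` / `Repr33_60` / `VacuumWhole` / `Decomp35_61`.  With the raw
printed remainders of §4/§4b these are `C₁ = rawConst C₁ʳ b₀ p₀ g κ₀`, `C₁' = rawConst C₁'ʳ b₀ p₀ g κ₀` (q = 18p₀: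
`cumulant58_of_raw`, `cumulantLower_of_raw`), `C₂ = rawConst7 C₂ʳ b₀ r₀ p₀ g κ₀`, `C₄ = rawConst7 C₄ʳ b₀ r₀ p₀ g κ₀`
(q = 7(r₀ + p₀): `repr33_60_of_raw`, `decomp35_61_of_raw`) and `C₃` = the large-localization constant of the vacuum
leaf (p. 264 [10] «with the constant proportional to an arbitrary power of g₀», p. 270 [16] «Terms with domains X,
which are not contained in a cube of the size R(g_k)M₁, are estimated by O((L^kε)^{3+κ₀})|T₁^{(k)}|» — not re-derived
here), so the coefficient is the closed-form real below: a function of the bare coupling g, of b₀, p₀, r₀, κ₀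
(0 < κ₀ < ½) and of the five constants C₁ʳ, C₁'ʳ, C₂ʳ, C₃, C₄ʳ (O(1)'s of the cluster expansions (24)/(58), (28)–(30),
(63) — leaves), and of NOTHING ELSE: not of k, not of ε, not of L^kε — the literal content of «independent of ε, k» at
the remainder term of (5), an admissible value of `Consts.rstar` (`rstarRaw_nonneg`, `rmSucc_of_booking`).  DISPLAY
ONLY: that the true densities (1)–(2) produce raw remainders with k-free Cʳ's is the content of the leaves.
[cite: Balaban1985UV3, (41) p.266 + Thm 1 p.257] -/
def rstarRaw (C₁ C₁' C₂ C₃ C₄ b₀ r₀ p₀ g κ₀ : ℝ) : ℝ :=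
  max (rawConst C₁ b₀ p₀ g κ₀) (rawConst C₁' b₀ p₀ g κ₀) + rawConst7 C₂ b₀ r₀ p₀ g κ₀ + C₃
    + rawConst7 C₄ b₀ r₀ p₀ g κ₀

/-- The display is literally the `rmSucc` sum of `B10SectAGathering.StepLeaves` at the raw constants. [folklore] -/
theorem rstarRaw_eq (C₁ C₁' C₂ C₃ C₄ b₀ r₀ p₀ g κ₀ : ℝ) :
    max (rawConst C₁ b₀ p₀ g κ₀) (rawConst C₁' b₀ p₀ g κ₀) + rawConst7 C₂ b₀ r₀ p₀ g κ₀ + C₃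
      + rawConst7 C₄ b₀ r₀ p₀ g κ₀ = rstarRaw C₁ C₁' C₂ C₃ C₄ b₀ r₀ p₀ g κ₀ := rfl

/-- Elementary: `0 ≤ rawConst` for `Craw ≥ 0`, `g > 0`, `p₀ ≥ 0`, `κ₀ < ½` (b₀¹⁸ ≥ 0 for every real b₀). [folklore] -/
theorem rawConst_nonneg {Craw b₀ p₀ g κ₀ : ℝ} (hC : 0 ≤ Craw) (hp : 0 ≤ p₀) (hg : 0 < g)
    (hκ : κ₀ < 1 / 2) : 0 ≤ rawConst Craw b₀ p₀ g κ₀ := by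
  have h12 : 0 < 1 - 2 * κ₀ := by linarith
  unfold rawConst
  positivity

/-- Elementary: `0 ≤ rawConst7` for `Craw, b₀ ≥ 0`, `g > 0`, `r₀ + p₀ ≥ 0`, `κ₀ < ½`. [folklore] -/
theorem rawConst7_nonneg {Craw b₀ r₀ p₀ g κ₀ : ℝ} (hC : 0 ≤ Craw) (hb : 0 ≤ b₀) (hrp : 0 ≤ r₀ + p₀) (hg : 0 < g)
    (hκ : κ₀ < 1 / 2) : 0 ≤ rawConst7 Craw b₀ r₀ p₀ g κ₀ := by
  have h12 : 0 < 1 - 2 * κ₀ := by linarith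
  unfold rawConst7
  positivity

/-- Elementary: the displayed coefficient is an honest `O(1) ≥ 0` (the sign condition `Consts.rstar_nonneg`). [folklore] -/
theorem rstarRaw_nonneg {C₁ C₁' C₂ C₃ C₄ b₀ r₀ p₀ g κ₀ : ℝ} (h₁ : 0 ≤ C₁) (h₁' : 0 ≤ C₁') (h₂ : 0 ≤ C₂)
    (h₃ : 0 ≤ C₃) (h₄ : 0 ≤ C₄) (hb : 0 ≤ b₀) (hr : 0 ≤ r₀) (hp : 0 ≤ p₀) (hg : 0 < g) (hκ : κ₀ < 1 / 2) :
    0 ≤ rstarRaw C₁ C₁' C₂ C₃ C₄ b₀ r₀ p₀ g κ₀ := by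
  have hrp : 0 ≤ r₀ + p₀ := by linarith
  have a := rawConst_nonneg (b₀ := b₀) h₁ hp hg hκ
  have a' := rawConst_nonneg (b₀ := b₀) h₁' hp hg hκ
  have b := rawConst7_nonneg h₂ hb hrp hg hκ
  have c := rawConst7_nonneg h₄ hb hrp hg hκ
  unfold rstarRaw
  have hm : 0 ≤ max (rawConst C₁ b₀ p₀ g κ₀) (rawConst C₁' b₀ p₀ g κ₀) := le_max_of_le_left a
  linarith

/-- Bookkeeping, DISPLAY: a run that books the remainder of step k as `Rm (k+1) = Rm k + c·(L^kε)^{3+κ₀}|T₁^{(k)}|`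
satisfies both the step leaf `RmSucc P c` of `B10SectAGathering.StepLeaves` and the leaf-system bound `Rm_succ_le` of
`LeafSystem` with `rstar := c`; with `c = rstarRaw …` this is ONE real number for every k and every run of the
family. [folklore] -/
theorem rmSucc_of_booking (P : StepPieces T k) {c : ℝ} (hb : T.Rm (k + 1) = T.Rm k + c * P.rem) :
    RmSucc P c ∧ T.Rm (k + 1) ≤ T.Rm k + c * P.rem := by
  refine ⟨?_, hb.le⟩
  unfold RmSucc
  exact hb.symm.le

end RawRemainder2

/-! ## 4c. The large-localization constant C₃ of the vacuum leaf, DISPLAYED (v1.2): «exp(−R), which is smaller than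
arbitrary power of ε» (p. 262) and «exp(−1/2 δ₀ dist(X, □₁ᶜ)) ≤ exp(−R₁r(g₀))» (p. 264) made quantitative -/

section RawRemainder3

variable {T : TowerRun} {k : ℕ}

/-- **«smaller than arbitrary power of ε», quantitatively.**  p. 257 [3], the sentence after (7): «We take R = R₁(1 +
log g₀⁻¹)^{r₀} = R₁r(g₀).»; p. 262 [8]: «It is easy to see that, because of the bound (23), the expressions
corresponding to big localization sets X are very small, especially if X is not contained in a cube of the size RM₁,
then the exponential factor in (23) yields the factor exp(−R), which is smaller than arbitrary power of ε. We estimate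
all such expressions using this bound and we get O(ε^κ)|T₁|.»; p. 264 [10]: «Finally we estimate terms with B localized
in □₁ᶜ by the last term in (30) with the constant proportional to an arbitrary power of g₀. It is possible because the
uniform exponential decay of all propagators provides the exponential factor exp(−1/2 δ₀ dist(X, □₁ᶜ)) ≤
exp(−R₁r(g₀)) in this case.»; k ≥ 1: (39) p. 266 [12] «(Lʲη)⁻¹ dist(Ωⱼᶜ, Ω_{j+1}) > R(g_j)M₁, R(g_j) = R₁r(g_j),» and p. 270 [16]
«Terms with domains X, which are not contained in a cube of the size R(g_k)M₁, are estimated by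
O((L^kε)^{3+κ₀})|T₁^{(k)}|.»  The quantitative form of the two quoted clauses, re-derived and kernel-checked (the
exp(−R) analogue of `B10.smallFactor_le_pow`, which does the same for the large-field factor exp(−½p²(g₀)) of (11)):
for `0 < g ≤ 1`, `r₀ ≥ 1` and every real `0 ≤ N ≤ R₁`, `exp(−R₁r(g)) ≤ e^{−R₁}·g^N` — the power of g (of ε at step 0:
g₀^N = g^N ε^{N/2}) is «arbitrary» exactly in so far as R₁ is at one's disposal.  Both side conditions are the cell's,
not the print's: r₀ is left free in print (cell GAPS G-B10-02) and for r₀ < 1 no bound `exp(−R₁r(g)) ≤ C·g^N`, N > 0,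
survives g → 0; the needed size of R₁ is never stated (cell SMALLNESS S-B10.9).
[cite: Balaban1985UV3, p.262 + p.264 + (7) p.257 + (39) p.266] -/
theorem largeLoc_le_rpow (r₀ R₁ g N : ℝ) (hr : 1 ≤ r₀) (hN0 : 0 ≤ N) (hN : N ≤ R₁) (hg : 0 < g)
    (hg1 : g ≤ 1) : Real.exp (-(R₁ * rFun r₀ g)) ≤ Real.exp (-R₁) * g ^ N := by
  have hu : 0 ≤ Real.log g⁻¹ := log_inv_nonneg_of_le_one hg hg1
  have hR : 0 ≤ R₁ := hN0.trans hN
  have h1 : 1 + Real.log g⁻¹ ≤ rFun r₀ g := by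
    have := Real.rpow_le_rpow_of_exponent_le (show (1 : ℝ) ≤ 1 + Real.log g⁻¹ by linarith) hr
    rw [Real.rpow_one] at this
    unfold rFun
    exact this
  have hgN : g ^ N = Real.exp (-(N * Real.log g⁻¹)) := by
    rw [Real.rpow_def_of_pos hg, Real.log_inv]
    congr 1
    ring
  rw [hgN, ← Real.exp_add, Real.exp_le_exp]
  have h2 : R₁ * (1 + Real.log g⁻¹) ≤ R₁ * rFun r₀ g := mul_le_mul_of_nonneg_left h1 hR
  have h3 : N * Real.log g⁻¹ ≤ R₁ * Real.log g⁻¹ := mul_le_mul_of_nonneg_right hN hu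
  linarith

/-- Elementary: `g_k^{2a} = g^{2a}(L^kε)^a` for `g_k = g(L^kε)^{1/2}` (`B10.gRun`), every real `a`, `0 < g, L, ε`.
[folklore] -/
theorem gRun_rpow_two_mul (g L ε a : ℝ) (k : ℕ) (hg : 0 < g) (hL : 0 < L) (hε : 0 < ε) :
    gRun g L ε k ^ (2 * a) = g ^ (2 * a) * (L ^ k * ε) ^ a := by
  have ht : 0 ≤ L ^ k * ε := by positivity
  unfold gRun
  rw [Real.mul_rpow hg.le (Real.sqrt_nonneg _), Real.sqrt_eq_rpow, ← Real.rpow_mul ht,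
    show (1 : ℝ) / 2 * (2 * a) = a by ring]

/-- The printed clause ALONG THE RUN (p. 270 [16], k ≥ 1, with R(g_k) = R₁r(g_k)): for `g_k = g(L^kε)^{1/2} ≤ 1`,
`r₀ ≥ 1`, `0 ≤ a` and `2a ≤ R₁`, `exp(−R₁r(g_k)) ≤ e^{−R₁}·g^{2a}·(L^kε)^a` — at `a = 3 + κ₀` the printed
«O((L^kε)^{3+κ₀})» with a constant `e^{−R₁}g^{6+2κ₀}` independent of k and ε.  Re-derived, kernel-checked.
[cite: Balaban1985UV3, p.270 + p.262] -/
theorem largeLoc_run_le (g L ε r₀ R₁ a : ℝ) (k : ℕ) (hg : 0 < g) (hL : 0 < L) (hε : 0 < ε) (hr : 1 ≤ r₀)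
    (ha : 0 ≤ a) (hR : 2 * a ≤ R₁) (hgk1 : gRun g L ε k ≤ 1) :
    Real.exp (-(R₁ * rFun r₀ (gRun g L ε k))) ≤ Real.exp (-R₁) * g ^ (2 * a) * (L ^ k * ε) ^ a := by
  have h := largeLoc_le_rpow r₀ R₁ (gRun g L ε k) (2 * a) hr (by linarith) hR (gRun_pos g L ε hg hL hε k) hgk1
  rw [gRun_rpow_two_mul g L ε a k hg hL hε, ← mul_assoc] at h
  exact h

/-- The k-FREE, ε-FREE constant in front of (L^kε)^{3+κ₀}|T₁^{(k)}| produced by `largeLoc_run_le` for a raw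
large-localization remainder `Craw·exp(−R₁r(g_k))·vol` (a = 3 + κ₀): `Craw·e^{−R₁}·g^{6+2κ₀}`.
[cite: Balaban1985UV3, p.262 + p.270] -/
def rawConstR (Craw R₁ g κ₀ : ℝ) : ℝ :=
  Craw * (Real.exp (-R₁) * g ^ (6 + 2 * κ₀))

/-- Elementary (the power counting of `largeLoc_run_le` at a = 3 + κ₀ along the run): `Craw·exp(−R₁r(g_k))·vol ≤
rawConstR·(L^kε)^{3+κ₀}|T₁^{(k)}|` for `0 ≤ vol ≤ |T₁^{(k)}|`, `g_k = g(L^kε)^{1/2} ≤ 1`, `κ₀ > 0`, `r₀ ≥ 1`,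
`R₁ ≥ 6 + 2κ₀`, `Craw ≥ 0`. [folklore] -/
theorem rawR_le (Craw r₀ R₁ vol g L ε κ₀ : ℝ) (hg : 0 < g) (hL : 0 < L) (hε : 0 < ε) (hκ : 0 < κ₀)
    (hr₀ : 1 ≤ r₀) (hR₁ : 6 + 2 * κ₀ ≤ R₁) (hC : 0 ≤ Craw) (hgk : T.g k = gRun g L ε k) (hgk1 : T.g k ≤ 1)
    (hvol0 : 0 ≤ vol) (hvol : vol ≤ T.sites k) :
    Craw * Real.exp (-(R₁ * rFun r₀ (T.g k))) * vol
      ≤ rawConstR Craw R₁ g κ₀ * ((L ^ k * ε) ^ (3 + κ₀) * T.sites k) := by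
  have hgk1' : gRun g L ε k ≤ 1 := by rw [← hgk]; exact hgk1
  have h1 := largeLoc_run_le g L ε r₀ R₁ (3 + κ₀) k hg hL hε hr₀ (by linarith) (by linarith) hgk1'
  rw [← hgk, show (2 : ℝ) * (3 + κ₀) = 6 + 2 * κ₀ by ring] at h1
  have hE : 0 ≤ Real.exp (-R₁) * g ^ (6 + 2 * κ₀) * (L ^ k * ε) ^ (3 + κ₀) := by positivity
  unfold rawConstR
  calc Craw * Real.exp (-(R₁ * rFun r₀ (T.g k))) * vol
      ≤ Craw * (Real.exp (-R₁) * g ^ (6 + 2 * κ₀) * (L ^ k * ε) ^ (3 + κ₀)) * vol :=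
        mul_le_mul_of_nonneg_right (mul_le_mul_of_nonneg_left h1 hC) hvol0
    _ ≤ Craw * (Real.exp (-R₁) * g ^ (6 + 2 * κ₀) * (L ^ k * ε) ^ (3 + κ₀)) * T.sites k :=
        mul_le_mul_of_nonneg_left hvol (mul_nonneg hC hE)
    _ = Craw * (Real.exp (-R₁) * g ^ (6 + 2 * κ₀)) * ((L ^ k * ε) ^ (3 + κ₀) * T.sites k) := by ring

/-- LEAF (the whole-lattice vacuum sum) with its large-localization part IN RAW FORM.  Printed loci as for
`B10SectAGathering.VacuumWhole`: k = 0, pp. 264–265 [10–11] «To obtain the whole counterterm we have to add a sum of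
the corresponding terms with localizations X satisfying X ∩ Ω₁ᶜ ≠ ∅. This sum can be bounded by O(g₀)|Ω₁ᶜ|.»; k ≥ 1,
p. 270 [16] «Terms with localization domains X having non-empty intersections with Ω_{k+1}ᶜ are estimated by
O(g_k)|Z_k|. Terms with domains X, which are not contained in a cube of the size R(g_k)M₁, are estimated by
O((L^kε)^{3+κ₀})|T₁^{(k)}|.»; the mechanism of the last clause is p. 262 [8] «the exponential factor in (23) yields
the factor exp(−R), which is smaller than arbitrary power of ε. We estimate all such expressions using this bound
and we get O(ε^κ)|T₁|.»  Typed: `|PprT − Ppr1 h| ≤ Cv·g_k·|Z_k| + Craw·exp(−R₁r(g_k))·vol h` — the bound of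
`VacuumWhole` with, in place of `C·rem`, the printed factor «exp(−R)», R = R(g_k) = R₁r(g_k) ((7) p. 257, (39)
p. 266), times `Craw·vol h` (vol h ≤ |T₁^{(k)}| = the number of big blocks that can carry a large localization; Craw
= the O(1)·O(g_k) of (23)/(25) summed, with the residual decay, over the localizations X through a given block that
are not contained in a cube of the size R(g_k)M₁).  TYPING, flagged (cell DIVERGENCE D-b10.13): the normalisation
«exp(−R)» of p. 262 is taken LITERALLY; p. 264 displays the mechanism as «exp(−1/2 δ₀ dist(X, □₁ᶜ)) ≤
exp(−R₁r(g₀))», i.e. a decay of rate ½δ₀ over a distance ≥ R(g₀)M₁, which is ≤ exp(−R) once ½δ₀M₁ ≥ 1 (an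
M₁-largeness of the kind of cell SMALLNESS S-B10.8); any other rate c·R is absorbed by R₁ ↦ cR₁ in the hypothesis
of `vacuumWhole_of_raw`.  The print displays no intermediate bound here.  A leaf, not a claim.
[cite: Balaban1985UV3, p.262 + pp.264–265 + p.270] -/
def VacuumWholeRaw (P : StepPieces T k) (Cv Craw r₀ R₁ : ℝ) (vol : T.Hist (k + 1) → ℝ) : Prop :=
  ∀ h : T.Hist (k + 1),
    |P.PprT - P.Ppr1 h| ≤ Cv * T.g k * P.Zvol h + Craw * Real.exp (-(R₁ * rFun r₀ (T.g k))) * vol h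

/-- **The printed «O(ε^κ)|T₁|» (p. 262) / «O((L^kε)^{3+κ₀})|T₁^{(k)}|» (p. 270) of the large localizations
discharged at the level of the leaf**: `VacuumWholeRaw P Cv Craw r₀ R₁ vol → VacuumWhole P Cv (rawConstR Craw R₁ g κ₀)`
for `vol ≤ |T₁^{(k)}|`, `g_k = g(L^kε)^{1/2} ≤ 1`, `κ₀ > 0`, PROVIDED `r₀ ≥ 1` and `R₁ ≥ 6 + 2κ₀` — a constant
independent of k and ε; the two provisos are the located content of «arbitrary power» (they are not printed).
Re-derived, kernel-checked (`rawR_le`). [cite: Balaban1985UV3, p.262 + p.264 + p.270] -/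
theorem vacuumWhole_of_raw (P : StepPieces T k) {Cv Craw r₀ R₁ : ℝ} {vol : T.Hist (k + 1) → ℝ}
    (g L ε κ₀ : ℝ) (hg : 0 < g) (hL : 0 < L) (hε : 0 < ε) (hκ : 0 < κ₀)
    (hr₀ : 1 ≤ r₀) (hR₁ : 6 + 2 * κ₀ ≤ R₁) (hC : 0 ≤ Craw)
    (hgk : T.g k = gRun g L ε k) (hgk1 : T.g k ≤ 1)
    (hvol0 : ∀ h, 0 ≤ vol h) (hvol : ∀ h, vol h ≤ T.sites k)
    (hrem : P.rem = (L ^ k * ε) ^ (3 + κ₀) * T.sites k)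
    (h : VacuumWholeRaw P Cv Craw r₀ R₁ vol) :
    VacuumWhole P Cv (rawConstR Craw R₁ g κ₀) := by
  intro h'
  rw [hrem]
  have hraw := rawR_le (T := T) (k := k) Craw r₀ R₁ (vol h') g L ε κ₀ hg hL hε hκ hr₀ hR₁ hC hgk hgk1
    (hvol0 h') (hvol h')
  linarith [h h']

/-- Elementary: `0 ≤ rawConstR` for `Craw ≥ 0`, `g > 0`. [folklore] -/
theorem rawConstR_nonneg {Craw R₁ g κ₀ : ℝ} (hC : 0 ≤ Craw) (hg : 0 < g) : 0 ≤ rawConstR Craw R₁ g κ₀ := by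
  unfold rawConstR
  positivity

/-- **The remainder coefficient of (41)/(47) with EVERY constant displayed** (v1.2): v1.1's `rstarRaw` at
`C₃ := rawConstR C₃ʳ R₁ g κ₀`, i.e.
`max (rawConst C₁ʳ …) (rawConst C₁'ʳ …) + rawConst7 C₂ʳ … + C₃ʳ·e^{−R₁}·g^{6+2κ₀} + rawConst7 C₄ʳ …` — a function of the
bare coupling g, of b₀, p₀, r₀, R₁, κ₀ (0 < κ₀ < ½, r₀ ≥ 1, R₁ ≥ 6 + 2κ₀ where it is USED: `vacuumWhole_of_raw`) and of
five cluster-expansion O(1)s C₁ʳ, C₁'ʳ, C₂ʳ, C₃ʳ, C₄ʳ (the constants of (24)/(58), of its lower direction (37), of the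
last term of (30) summed as in (33)/(60), of (23)/(25) summed over the large localizations, of the (61)-expansion),
and of NOTHING ELSE — Theorem 1's «the constant O(1) is independent of ε, k, g_k in a bounded set» (p. 257 [3]) made
literal at the remainder term, now without a bare slot.  DISPLAY ONLY: that the true densities (1)–(2) produce raw
remainders of these shapes with k-free Cʳ's is the content of the leaves. [cite: Balaban1985UV3, (41) p.266 + Thm 1 p.257] -/
def rstarRawR (C₁ C₁' C₂ C₃ C₄ b₀ r₀ p₀ R₁ g κ₀ : ℝ) : ℝ :=
  rstarRaw C₁ C₁' C₂ (rawConstR C₃ R₁ g κ₀) C₄ b₀ r₀ p₀ g κ₀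

/-- The display is literally the `rmSucc` sum of `B10SectAGathering.StepLeaves` at the raw constants, the vacuum
slot included. [folklore] -/
theorem rstarRawR_eq (C₁ C₁' C₂ C₃ C₄ b₀ r₀ p₀ R₁ g κ₀ : ℝ) :
    max (rawConst C₁ b₀ p₀ g κ₀) (rawConst C₁' b₀ p₀ g κ₀) + rawConst7 C₂ b₀ r₀ p₀ g κ₀
      + rawConstR C₃ R₁ g κ₀ + rawConst7 C₄ b₀ r₀ p₀ g κ₀ = rstarRawR C₁ C₁' C₂ C₃ C₄ b₀ r₀ p₀ R₁ g κ₀ := rfl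

/-- Elementary: the fully displayed coefficient is an honest `O(1) ≥ 0` (the sign condition `Consts.rstar_nonneg`).
[folklore] -/
theorem rstarRawR_nonneg {C₁ C₁' C₂ C₃ C₄ b₀ r₀ p₀ R₁ g κ₀ : ℝ} (h₁ : 0 ≤ C₁) (h₁' : 0 ≤ C₁') (h₂ : 0 ≤ C₂)
    (h₃ : 0 ≤ C₃) (h₄ : 0 ≤ C₄) (hb : 0 ≤ b₀) (hr : 0 ≤ r₀) (hp : 0 ≤ p₀) (hg : 0 < g) (hκ : κ₀ < 1 / 2) :
    0 ≤ rstarRawR C₁ C₁' C₂ C₃ C₄ b₀ r₀ p₀ R₁ g κ₀ :=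
  rstarRaw_nonneg h₁ h₁' h₂ (rawConstR_nonneg h₃ hg) h₄ hb hr hp hg hκ

end RawRemainder3

/-! ## 5. The leaf system is jointly satisfiable: the trivial (empty-interaction) run of every depth K -/

section Witness

/-- Family constants of the trivial model: g = 1, L = 2, κ₀ = 1/4, p₀ = 1, M₁ = b₀ = 0 and every O(1) = 0.
(A consistency witness for the hypothesis bundle, nothing about gauge theory.) [folklore] -/
def trivConsts : Consts where
  g := 1
  L := 2
  κ₀ := 1 / 4
  M₁ := 0
  b₀ := 0
  p₀ := 1
  C46 := 0
  σmax := 0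
  dg := 0
  z := 0
  aP := 0
  rstar := 0
  d := 0
  g_pos := one_pos
  one_lt_L := by norm_num
  κ₀_pos := by norm_num
  M₁_nonneg := le_rfl
  p₀_pos := one_pos
  C46_nonneg := le_rfl
  σmax_nonneg := le_rfl
  dg_nonneg := le_rfl
  z_nonneg := le_rfl
  aP_nonneg := le_rfl
  rstar_nonneg := le_rfl
  d_nonneg := le_rfl

/-- The trivial run of depth K on spacing ε = 2^{−K} (so L^kε ≤ 1 for all k ≤ K, K arbitrary): one configuration
and one history per scale, ρ_k ≡ χ_k ≡ 1, all actions / interactions / counterterms / Z-terms / remainders 0,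
LF_k(U, F) = exp F(·), the carrier scaling g_k = (2^kε)^{1/2}, |T₁^{(k)}| = (2^kε)^{−3}. [folklore] -/
def trivRun (K : ℕ) : TowerRun where
  K := K
  Cfg := fun _ => Unit
  ρ := fun _ _ => 1
  χ := fun _ _ => 1
  wilsonBG := fun _ _ => 0
  sites := sitesRun 2 (((2 : ℝ) ^ K)⁻¹) 1
  g := gRun 1 2 (((2 : ℝ) ^ K)⁻¹)
  Ineq41_47 := fun _ => True
  Hist := fun _ => Unit
  triv := fun _ => ()
  LF := fun _ _ F => Real.exp (F ())
  lf_mono := fun _ _ F G hFG => Real.exp_le_exp.mpr (hFG ())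
  lf_shift := fun _ _ F t => by
    show Real.exp (F () + t) = Real.exp t * Real.exp (F ())
    rw [Real.exp_add, mul_comm]
  mainT := fun _ _ _ => 0
  mainT_triv := fun _ _ => by simp
  Pint := fun _ _ _ => 0
  Λvol := fun _ _ => 0
  Λvol_le := fun k _ => sitesRun_nonneg 2 _ 1 (by norm_num) (by positivity) zero_le_one k
  Zterm := fun _ _ => 0
  Zterm_triv := fun _ => rfl
  Ecst := fun _ => 0
  Estep := fun _ => 0
  Ecst_eq := fun _ => by simp
  Rm := fun _ => 0
  χ_nonneg := fun _ _ => zero_le_one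
  sites_nonneg := fun k => sitesRun_nonneg 2 _ 1 (by norm_num) (by positivity) zero_le_one k
  M₁ := 0
  b₀ := 0
  p₀ := 1

/-- The step pieces of the trivial run: everything 0, the remainder unit the carrier's (2^kε)^{3+¼}|T₁^{(k)}|. [folklore] -/
def trivPieces (K k : ℕ) : StepPieces (trivRun K) k where
  proj := fun _ => ()
  proj_triv := rfl
  Zvol := fun _ => 0
  Zvol_nonneg := fun _ => le_rfl
  Zvol_triv := rfl
  starB := fun _ => 0
  starT := 0
  logσ₀ := 0
  dg := 0
  dg_nonneg := le_rfl
  logZU := fun _ _ => 0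
  logZ1 := fun _ => 0
  logZT := 0
  logFl := fun _ _ => 0
  PprU := fun _ _ => 0
  Ppr1 := fun _ => 0
  PprT := 0
  PY := fun _ _ => 0
  PYZ := fun _ _ => 0
  Pold := fun _ _ => 0
  PoldIn := fun _ _ => 0
  rem := ((2 : ℝ) ^ k * ((2 : ℝ) ^ K)⁻¹) ^ ((3 : ℝ) + 1 / 4) * sitesRun 2 (((2 : ℝ) ^ K)⁻¹) 1 k
  rem_nonneg := mul_nonneg (Real.rpow_nonneg (by positivity) _)
    (sitesRun_nonneg 2 _ 1 (by norm_num) (by positivity) zero_le_one k)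

/-- The fourteen step leaves hold for the trivial run with all constants 0. [folklore] -/
def trivLeaves (K k : ℕ) : StepLeaves (trivRun K) k where
  P := trivPieces K k
  Cz := 0
  C₁ := 0
  C₁' := 0
  C₂ := 0
  Cv := 0
  C₃ := 0
  C₄ := 0
  C₅ := 0
  c₁ := 0
  C₆ := 0
  bound55 := fun _ U => by simp [trivRun, trivPieces]
  bound55Lower := fun _ U => by simp [trivRun, trivPieces]
  cumulant58 := fun h U => by simp [trivRun, trivPieces]
  cumulantLower := fun U => by simp [trivRun, trivPieces]
  repr33_60 := fun h U => by simp [trivPieces]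
  vacuumWhole := fun h => by simp [trivRun, trivPieces]
  decomp35_61 := fun h U => by simp [trivPieces]
  norm35 := fun h => by simp [trivPieces]
  starCount := fun h => by simp [trivPieces]
  oldOutside := fun h U => by simp [trivPieces]
  pintSucc := fun h U => by simp [trivRun, trivPieces]
  estep62 := by simp [Estep62, trivRun, trivPieces]
  ztermSucc := fun h => by simp [trivRun, trivPieces]
  rmSucc := by simp [RmSucc, trivRun, trivPieces]

/-- Elementary: 2^k · 2^{−K} ≤ 1 for k ≤ K. [folklore] -/
theorem two_pow_mul_inv_le_one {K k : ℕ} (hk : k ≤ K) : (2 : ℝ) ^ k * ((2 : ℝ) ^ K)⁻¹ ≤ 1 := by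
  rw [mul_inv_le_iff₀ (by positivity), one_mul]
  exact pow_le_pow_right₀ (by norm_num) hk

/-- **THE LEAF SYSTEM IS INHABITED (for every depth K)**: the trivial run carries a leaf system for the trivial
constants — so the hypothesis bundle `LeafSystem` (25 fields: 2 data, 23 named hypotheses, among them the fourteen
step leaves at every k < K) is jointly satisfiable and the assembly theorems are not vacuously true (gen-6 owed item (β)).  A consistency
check of the TYPING, not a statement about Yang–Mills. [folklore] -/
def trivLeafSystem (K : ℕ) : LeafSystem trivConsts (trivRun K) where
  ε := ((2 : ℝ) ^ K)⁻¹
  Tε := 1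
  ε_pos := by positivity
  Tε_nonneg := zero_le_one
  g_eq := fun _ => rfl
  sites_eq := fun _ => rfl
  scale_le_one := fun k hk => two_pow_mul_inv_le_one hk
  g_le_one := fun k hk => by
    show 1 * Real.sqrt ((2 : ℝ) ^ k * ((2 : ℝ) ^ K)⁻¹) ≤ 1
    rw [one_mul]
    calc Real.sqrt ((2 : ℝ) ^ k * ((2 : ℝ) ^ K)⁻¹) ≤ Real.sqrt 1 := Real.sqrt_le_sqrt (two_pow_mul_inv_le_one hk)
      _ = 1 := Real.sqrt_one
  par := ⟨rfl, rfl, rfl⟩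
  spec := fun k => ⟨fun _ => ⟨fun U => by simp [trivRun], fun U => by simp [trivRun]⟩, fun _ => trivial⟩
  step0 := ⟨fun U => by simp [trivRun], fun U => by simp [trivRun]⟩
  noInt0 := fun _ _ => rfl
  steps := fun k _ => trivLeaves K k
  Λvol_nonneg := fun _ _ => le_rfl
  bound46 := fun k _ _ h U => by simp [trivRun, trivConsts]
  starT_nonneg := fun _ _ => le_rfl
  starT_le := fun k _ => by
    show (0 : ℝ) ≤ 3 * (trivRun K).sites k
    exact mul_nonneg (by norm_num) ((trivRun K).sites_nonneg k)
  logσ₀_le := fun _ _ => by simp [trivPieces, trivLeaves, trivConsts]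
  dg_le := fun _ _ => le_rfl
  logZT_le := fun _ _ => by simp [trivPieces, trivLeaves, trivConsts]
  PprT_le := fun _ _ => by simp [trivPieces, trivLeaves, trivConsts]
  rem_eq := fun k _ => by
    show ((2 : ℝ) ^ k * ((2 : ℝ) ^ K)⁻¹) ^ ((3 : ℝ) + 1 / 4) * sitesRun 2 (((2 : ℝ) ^ K)⁻¹) 1 k = _
    rfl
  Rm_zero := le_rfl
  Rm_succ_le := fun k _ => by simp [trivRun, trivConsts]
  lf := fun k _ U => by simp [trivRun, trivConsts]

/-- The hypothesis bundle is inhabited for every depth K (the trivial run). [folklore] -/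
theorem leafSystem_nonempty (K : ℕ) : Nonempty (LeafSystem trivConsts (trivRun K)) :=
  ⟨trivLeafSystem K⟩

/-- … and the assembly theorem applies to it (one-member family). [folklore] -/
theorem trivRun_thm1Compact_and_thm2 (K : ℕ) :
    Thm1PrintedCompact (fun _ : Unit => (trivRun K).toRunData)
      ∧ Thm2Printed (fun _ : Unit => (trivRun K).toRunData) :=
  thm1Compact_and_thm2_of_leafSystem (fun _ : Unit => trivRun K) (fun _ => trivLeafSystem K)

end Witness

/-! ## 6. The finite-dimensional identities behind (20) and (21) (Sect. A, p. 261) -/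

section Eq20_21

variable {o n m R : Type*} [Fintype o] [DecidableEq o] [Fintype n] [DecidableEq n] [Fintype m] [DecidableEq m]
  [CommRing R]

omit [Fintype o] [Fintype n] [Fintype m] in
/-- Elementary block algebra: `1 − [[A, B], [0, 0]] = [[1 − A, −B], [0, 1]]`. [folklore] -/
theorem one_sub_fromBlocks_zero (A : Matrix (n × o) (n × o) R) (B : Matrix (n × o) m R) :
    (1 : Matrix ((n × o) ⊕ m) ((n × o) ⊕ m) R) - Matrix.fromBlocks A B 0 0
      = Matrix.fromBlocks (1 - A) (-B) 0 1 := by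
  rw [← Matrix.fromBlocks_one, sub_eq_add_neg, Matrix.fromBlocks_neg, Matrix.fromBlocks_add]
  simp [sub_eq_add_neg]

/-- **(20)** p. 261 [7] «exp Tr log(I − (δ/δA)D̃(A)) = exp[Σ_{c∈Ω₁^{(1)}} tr log(1 − (∂/∂A(b₀(c)))D̃(A, b₀(c), c))],
in the exponential the sum is over almost local functions.», under p. 260 [6] «We assume that D̃(A, b, c) = 0 for
all b ≠ b₀(c). This assures the locality properties.» — THE FINITE-DIMENSIONAL IDENTITY BEHIND IT, typed with the
support made an explicit hypothesis (cell GAPS G-adv9-44: (20) is exact iff the coarse–coarse off-diagonal blocks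
∂D̃(A, b₀(c), c)/∂A(b₀(c′)), c′ ≠ c, vanish; the printed support sentence alone does not say so, the true support
— D̃(·, b₀(c), c) depends on A only inside B(c₋) ∪ B(c₊) and on the connecting set of c — does).  Index the variables
A(b) by (𝔤-components × coarse bonds c) ⊕ (the other bonds); the Jacobian (δ/δA)D̃(A) has ZERO rows off the coarse
bonds (D̃(A, b, ·) = 0 for b ∉ b₀(Ω₁^{(1)})) and a BLOCK-DIAGONAL coarse–coarse part with d(𝔤) × d(𝔤) blocks
J_c = (∂/∂A(b₀(c)))D̃(A, b₀(c), c): then `det(1 − [[⊕_c J_c, B], [0, 0]]) = Π_c det(1 − J_c)` for ANY coarse–other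
block B, i.e. exp Tr log(I − δD̃/δA) = exp Σ_c tr log(1 − J_c) whenever the logarithms are defined.  Kernel-checked
(Mathlib `Matrix.det_fromBlocks_zero₂₁`, `Matrix.det_blockDiagonal`); the identification of δD̃/δA with a matrix
of this shape is the (repaired) printed support clause, a hypothesis of Sect. A's leaf (22), not proved here.
[cite: Balaban1985UV3, (20) p.261 + p.260] -/
theorem eq20_det_blockTriangular (J : o → Matrix n n R) (B : Matrix (n × o) m R) :
    (1 - Matrix.fromBlocks (Matrix.blockDiagonal J) B 0 0).det = ∏ c, (1 - J c).det := by
  rw [one_sub_fromBlocks_zero, Matrix.det_fromBlocks_zero₂₁, Matrix.det_one, mul_one,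
    ← Matrix.blockDiagonal_one, ← Matrix.blockDiagonal_sub, Matrix.det_blockDiagonal]
  rfl

/-- **(21)** p. 261 [7] «(σ/σ₀)(A − D̃(A)) = exp[Σ_{b∈Ω₁}(log σ/σ₀)(A(b) − D̃(A, c(b), b))]. Let us denote the terms in
the exponentials in (20), (21) by v(A).» — the identity behind it: a finite product of positive factors is the
exponential of the sum of their logarithms ((σ/σ₀)(A′) = Π_{b∈Ω₁}(σ/σ₀)(A′(b)) > 0 near A′ = 0, σ(0) = σ₀).
Kernel-checked. [cite: Balaban1985UV3, (21) p.261] -/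
theorem eq21_prod_eq_exp_sum_log {ι : Type*} (s : Finset ι) (f : ι → ℝ) (hf : ∀ b ∈ s, 0 < f b) :
    ∏ b ∈ s, f b = Real.exp (∑ b ∈ s, Real.log (f b)) := by
  rw [Real.exp_sum]
  exact Finset.prod_congr rfl fun b hb => (Real.exp_log (hf b hb)).symm

end Eq20_21

end Literature.MathematicalPhysics.QuantumFieldTheory.Balaban1983to89.B10Assembly
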